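import Literature.Analysis.FluidPDE.TorusNSTranYuPressureRatioCriterion
import Literature.Analysis.FluidPDE.TorusVelocityMomentBalance
import Literature.Analysis.FluidPDE.TorusNSSerrinCriterion
import Literature.Analysis.FluidPDE.TorusNSBeiraoDaVeigaCriterion
import Literature.Analysis.FluidPDE.TorusNSChessboardTimeAverages
import Literature.Analysis.FluidPDE.TorusNSFoiasGuillopeTemam
import Literature.Analysis.FluidPDE.TorusNSBerselliGaldiCriterionLowest
import Literature.Analysis.FluidPDE.ExtremeGrowthVorticityControl
import Literature.Analysis.FunctionSpaces.TorusSobolevL6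
import Literature.Analysis.FunctionSpaces.LadyzhenskayaTorus
import Literature.Analysis.FunctionSpaces.TorusSpaceTimeComposition
import Literature.Analysis.FunctionSpaces.TorusEnstrophyOrthogonality
import Literature.Analysis.FunctionSpaces.TorusClassicalNSGluing
import Literature.Analysis.FluidPDE.NSWave0
import HarnessLib

/-!
# Vasseur's velocity-direction criterion on `T³`: `div (u/|u|) ∈ L^p(0,T; L^q)`,
# `2/p + 3/q ≤ 1/2`, `q ≥ 6`, prevents blow-up (continuation form)

Analysis/FluidPDE proof file (theorems only; no definitions, no named facts).

Source: A. Vasseur, *Regularity criterion for 3D Navier–Stokes equations in terms of the direction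
of the velocity*, Appl. Math. **54** (2009), no. 1, 47–52 = arXiv:0705.2446 (held text
`paper:arxiv-0705.2446`, pp. 1–3). Printed (`ℝ³`, `ν = 1`, Leray–Hopf solutions):

"**Theorem 1.** Let `u` be a Leray–Hopf solution to Navier–Stokes equations with initial value
`u₀ ∈ L²(ℝ³)`. If `div(u/|u|) ∈ L^p(0,∞; L^q(ℝ³))` with `2/p + 3/q ≤ 1/2`, `q ≥ 6`, `p ≥ 4`, then
`u` is smooth on `(0,∞) × ℝ³`." "The main point of this modest paper is the following
straightforward equality coming from the incompressibility of the flow: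
`|u| div(u/|u|) = −(u/|u|)·∇|u|` (3) … `= −(u/(2|u|²))·∇|u|² = −(uᵀ/|u|²)·∇u·u`."
Proof (p. 2–3): "Multiplying (1) by `u|u|`, and integrating in `x` we find
`d/dt ∫|u|³/3 + ∫|u|(|∇u|² + |∇|u||²) − ∫ P u·∇|u| = 0`"; "`‖P‖_{L^{3r/4}} ≤ C_r‖u‖²_{L^{3r/2}}`";
"there exists `p̄ > 1` and `2 < q̄ < 6` such that `|u| div(u/|u|) ∈ L^{p̄}(L^{q̄})` with
`1/p̄ = 1/p + 1/a`, `1/q̄ = 1/q + 1/b` [`u ∈ L^a(L^b)`, `2/a + 3/b = 3/2`] … `2/p̄ + 3/q̄ ≤ 2` (2)";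
"**Lemma 2.** For every `2 ≤ r < 6` there exists `C` such that for every `β > 0` …
`β‖f‖²_{L^r} ≤ ¼‖∇f‖²_{L²} + Cβ^{1/θ}‖f‖²_{L²}`, `θ = 3/r − 1/2`" (applied to `f = |u|^{3/2}`);
"Gronwall argument gives `lim_{t→T}∫|u|³ < ∞`, and so `∫∫|u||∇|u||² = (4/9)∫∫|∇|u|^{3/2}|²` is
finite too. Sobolev imbedding gives `u ∈ L³(t₀,T;L⁹)`", contradicting Serrin's criterion.

Here on the unit torus `T^d`, `card d = 3`, in the tree's classical vocabulary and in CONTINUATION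
FORM at a putative blow-up time (as the tree renders every criterion of this kind, cf. the sibling
files `TorusNSSerrinCriterion`, `TorusNSBeiraoDaVeigaCriterion`, `TorusNSTranYuPressureRatioCriterion`).
The printed quantity `|u| div(u/|u|)` is, by the printed identity (3), the quotient
`−⟪u, (u·∇)u⟫/|u|²` off the zero set of `u`; the hypothesis is therefore stated QUOTIENT-FREE as a
pointwise majorant `D ≥ 0` of it: `|⟪u, (u·∇)u⟫| ≤ |u|² D` (automatic where `u = 0`; equivalent to
`||u| div(u/|u|)| ≤ D` where `u ≠ 0`, `Vasseur2009.abs_norm_mul_divergence_dir_le_iff`). The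
scalar `σ(u) = ⟪u, (u·∇)u⟫ = u·∇(½|u|²)` is the SELF-STRAIN of the velocity (the fine structure of
the cell's door S22 «SelfStrainDoor»; Tran–Yu 2015 (9): `û·∇|u| = σ/|u|²` drives every `L^q` norm).

* `Vasseur2009.norm_mul_divergence_dir_eq` — **the identity (3)** on `T^d`: for a `C¹` field `v`
  and a point `x` with `div v(x) = 0`, `v(x) ≠ 0`:
  `|v(x)| · div(v/|v|)(x) = −⟪v(x), (v·∇)v(x)⟫ / |v(x)|²`;
  `Vasseur2009.norm_mul_divergence_dir_eq_of_fderiv` — the same identity on a finite-dimensional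
  real inner product space in the summit's currency (`NSWave0.divergence v x = tr Dv(x)`, self-strain
  `⟪v(x), Dv(x) v(x)⟫`, as in the cell's door S22).
* `Vasseur2009.exists_deriv_le_of_selfStrain_le` — **the `L³`-type budget with the pressure term
  kept and bounded through the direction hypothesis, Lemma 2 absorbed** (the printed chain
  p. 2–3 with `|u|` replaced by the smooth weight `w = (|u|² + 1)^{1/2} ≥ |u|`, which avoids the
  non-smooth weight `|u|³` at the zero set and changes nothing else): there are `K₁, K₂ ≥ 0`
  (depending on `d`, `ν`, `q`) such that along every classical solution of the unforced equations
  on `[a, b] × T^d` and every `t`, if `|⟪u, (u·∇)u⟫| ≤ |u|² D` with `D ≥ 0` continuous and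
  `(∫D^q)^{1/q} ≤ N`, `3/2 < q < ∞`, then `F(s) = ∫(|u(s)|² + 1)^{3/2}` has a one-sided derivative `R`
  at `t` with `R + (2ν/3) ∫|∇(|u|²+1)^{3/4}|² ≤ (K₁ N^{2q/(2q−3)} + K₂) F(t)`
  (`2q/(2q−3) = 1/θ`, the printed Grönwall exponent; equality case of (2)).
* `Torus.classicalNS_continuation_of_selfStrain_Lq_rpow_integral_le` — **the criterion (2) on
  `T³`, continuation form**: a classical mean-zero solution on `[0, T) × T^d`, a dominating family
  `D(t) ≥ 0` of `|u| div(u/|u|)` as above, `3/2 < q < ∞`, a continuous majorant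
  `N(t) ≥ ‖D(t)‖_{L^q}` and `∫₀ᵗ N^γ ≤ I` on `[0, T)` with `2/γ + 3/q ≤ 2` ⇒ the solution continues
  past `T` (Grönwall ⇒ `sup ∫ w³` and `∫∫|∇w^{3/2}|²` bounded ⇒ `∫₀ᵀ ‖u‖³_{L⁹} < ∞` by the `H¹ ⊂ L⁶`
  embedding of `w^{3/2}` ⇒ Serrin with `(s, r) = (9, 3)`, tree
  `Torus.classicalNS_continuation_of_Ls_rpow_integral_le`). Printed range `2 ≤ q̄ < 6`; the proof
  gives `3/2 < q̄ < ∞` verbatim, which is what is typed.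
* `Torus.classicalNS_continuation_of_divergence_dir_Lq_rpow_integral_le` — **Theorem 1 on `T³`,
  continuation form**: a dominating family `E(t) ≥ 0` of `div(u/|u|)` itself
  (`|⟪u, (u·∇)u⟫| ≤ |u|³ E`), `6 < q < ∞`, `2/p + 3/q ≤ 1/2`, a continuous majorant
  `N(t) ≥ ‖E(t)‖_{L^q}` with `∫₀ᵗ N^p ≤ I` ⇒ continuation (from the previous theorem with
  `D = |u| E`, `1/q̄ = 1/q + 1/6`, the energy-class bound `∫₀ᵀ‖u‖²_{L⁶} ≤ C‖u₀‖₂²/ν` and Young's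
  inequality in time — the printed `(a, b) = (2, 6)`); and
  `Torus.classicalNS_continuation_of_divergence_dir_L6_le` — the endpoint `q = 6`, `p = ∞`.

Scope (faithfulness): classical solutions with mean-zero slices on the unit torus in place of
Leray–Hopf solutions on `ℝ³` ("smooth on `(0,∞) × ℝ³`" becomes "no first blow-up time", as in
every torus criterion file of the tree); `L^p_t` hypotheses as continuous majorants with bounded
primitive; the periodic Calderón–Zygmund bound `‖p − ⟨p⟩‖_{L^γ} ≤ C‖u‖²_{L^{2γ}}`
(`Torus.exists_pressure_sub_average_Ls_le_normSq`, Berselli–Galdi 2002 (1.6)) replaces the printed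
`‖P‖_{L^{3r/4}} ≤ C_r‖u‖²_{L^{3r/2}}` on `ℝ³`; Lemma 2 is used through the tree's `L²–L⁶`
interpolation and the `H¹(T³) ⊂ L⁶` embedding (with the inhomogeneous `‖f‖₂²` term, `f = w^{3/2}`
not being mean-free), its constant absorbed into `K₁, K₂`.

## Mathlib / tree search

Tree (used): `Torus.IsClassicalNSSolutionOn.hasDerivWithinAt_integral_comp_normSq` (the exact
weighted balance `d/dt∫Ψ(|u|²)`, `TorusVelocityMomentBalance`), `Torus.exists_pressure_sub_average_Ls_le_normSq`,
`Torus.integral_rpow_le_interpolate_two_six'`, `Torus.lintegral_enorm_pow_six_le_cube_of_isSmooth`,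
`Torus.norm_fderiv_sq_le_card_mul_sum`, `Torus.exists_integral_norm_pow_six_le_gradNormSq_cube`,
`Torus.classicalNS_integral_gradNormSq_le`, `le_mul_exp_integral_of_hasDerivWithinAt_le_mul`,
`Torus.classicalNS_continuation_of_Ls_rpow_integral_le`; Mathlib `integral_mul_le_Lp_mul_Lq_of_nonneg`,
`Real.geom_mean_le_arith_mean2_weighted`, `HasDerivAt.norm_sq`, `HasFDerivAt.norm_sq`,
`LinearMap.trace_eq_sum_inner` (trace of a rank-one map). Searched (`lean search`):
`Vasseur|direction of the velocity|div\(u/\|u\|\)|selfStrain|velocityDirection` — declarations: only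
`LeiRenTian2025_velocityDirection_axisymmetric` (a different, axisymmetric statement) and the
Summits-side door files; no velocity-direction / self-strain regularity criterion in the tree.

## References

* [Vasseur2009] A. Vasseur, Appl. Math. 54 (2009) 47–52, doi:10.1007/s10492-009-0003-y =
  arXiv:0705.2446: Thm 1, eq. (2), eq. (3), Lemma 2 and the proof pp. 2–3 (held).
* [TranYu2015] C. V. Tran, X. Yu, Nonlinearity 28 (2015) 1295, eq. (9) (the `L^q` balance driven
  by `∫ p|u|^{q−2} û·∇|u|`; tree `TorusNSTranYuPressureRatioCriterion`).
* [RobinsonRodrigoSadowski2016] Ch. 11 Exercise 11.4 (the weighted balance), Lemma 8.16 (method).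
* [BerselliGaldi2002] Proc. AMS 130 (2002), (1.6) (periodic Calderón–Zygmund bound).
-/

noncomputable section

open MeasureTheory Finset Set Filter Topology
open scoped InnerProductSpace RealInnerProductSpace ContDiff

namespace Literature.Analysis.FluidPDE

open Literature.Analysis.FunctionSpaces

variable {d : Type*} [Fintype d] [DecidableEq d]

namespace Vasseur2009

/-! ### §0 Helpers (private copies of tree devices) -/

/-- Shifting the pressure by a constant gives again a classical solution. [folklore] -/
private theorem pressure_sub_const {S : Set ℝ} {ν : ℝ}
    {f u : ℝ → UnitAddTorus d → EuclideanSpace ℝ d} {p : ℝ → UnitAddTorus d → ℝ}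
    (h : Torus.IsClassicalNSSolutionOn S ν f u p) (c : ℝ) :
    Torus.IsClassicalNSSolutionOn S ν f u (fun t x => p t x - c) where
  smooth_velocity := h.smooth_velocity
  smooth_pressure :=
    h.smooth_pressure.sub (Torus.isSmoothSpaceTimeOn_const (Torus.isSmooth_const c) S)
  momentum t ht x := by
    rw [Torus.gradient_sub_const_apply]
    exact h.momentum t ht x
  divFree := h.divFree

omit [DecidableEq d] in
/-- Hölder on `T^d` with weights `a + b = 1` for continuous non-negative `f, g`:
`∫ f g ≤ (∫ f^{1/a})^a (∫ g^{1/b})^b`. [folklore] -/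
private theorem integral_mul_le_rpow_mul_rpow {f g : UnitAddTorus d → ℝ} (hf : Continuous f)
    (hg : Continuous g) (hf0 : ∀ x, 0 ≤ f x) (hg0 : ∀ x, 0 ≤ g x) {a b : ℝ} (ha : 0 < a)
    (hb : 0 < b) (hab : a + b = 1) :
    ∫ x, f x * g x ≤ (∫ x, f x ^ a⁻¹) ^ a * (∫ x, g x ^ b⁻¹) ^ b := by
  have hpq : (a⁻¹).HolderConjugate b⁻¹ := Real.HolderConjugate.inv_inv ha hb hab
  have h := integral_mul_le_Lp_mul_Lq_of_nonneg (μ := volume) hpq (ae_of_all _ hf0)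
    (ae_of_all _ hg0) (hf.memLp_of_hasCompactSupport (HasCompactSupport.of_compactSpace f))
    (hg.memLp_of_hasCompactSupport (HasCompactSupport.of_compactSpace g))
  simpa only [one_div, inv_inv] using h

/-- Chain rule for partial derivatives through a scalar function: `∂ₖ(g ∘ θ) = g'(θ) ∂ₖθ` at points
where `g` is differentiable (`θ` of class `C¹`). [folklore] -/
private theorem partialDeriv_comp_deriv {g : ℝ → ℝ} {θ : UnitAddTorus d → ℝ}
    (hθ : Torus.IsContDiff 1 θ) (x : UnitAddTorus d) (hg : DifferentiableAt ℝ g (θ x)) (k : d) :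
    Torus.partialDeriv k (fun y => g (θ y)) x = deriv g (θ x) * Torus.partialDeriv k θ x := by
  unfold Torus.partialDeriv Torus.lineDeriv
  set v : EuclideanSpace ℝ d := EuclideanSpace.single k 1
  have hθ' : HasDerivAt (fun s : ℝ => θ (x + Torus.proj (s • v))) (Torus.lineDeriv θ x v) 0 := by
    simpa using Torus.hasDerivAt_comp_add_proj_smul hθ x v 0
  have hx0 : θ (x + Torus.proj ((0 : ℝ) • v)) = θ x := by simp
  have hg' : HasDerivAt g (deriv g (θ (x + Torus.proj ((0 : ℝ) • v))))
      (θ (x + Torus.proj ((0 : ℝ) • v))) := by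
    rw [hx0]; exact hg.hasDerivAt
  have hc := hg'.comp 0 hθ'
  have hfun : (fun t : ℝ => (fun y => g (θ y)) (x + Torus.proj (t • v))) =
      g ∘ fun s : ℝ => θ (x + Torus.proj (s • v)) := rfl
  rw [hfun, hc.deriv, hx0, hθ'.deriv]

/-- **`H¹(T³) ⊂ L⁶(T³)` for smooth real functions, Bochner form with partial derivatives**: on
`T^d`, `card d = 3`, there is `K ≥ 0` with `∫ f⁶ ≤ K (∫ f² + ∫ ∑ₖ (∂ₖf)²)³` for every smooth
`f : T^d → ℝ` (the tree's embedding `Torus.lintegral_enorm_pow_six_le_cube_of_isSmooth` and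
`‖Df‖² ≤ d ∑ₖ(∂ₖf)²`). [folklore] -/
private theorem exists_integral_pow_six_le (hd : Fintype.card d = 3) :
    ∃ K : ℝ, 0 ≤ K ∧ ∀ f : UnitAddTorus d → ℝ, Torus.IsSmooth f →
      ∫ x, f x ^ 6 ≤ K * ((∫ x, f x ^ 2) + ∫ x, ∑ k, Torus.partialDeriv k f x ^ 2) ^ 3 := by
  obtain ⟨K, hK⟩ := Torus.lintegral_enorm_pow_six_le_cube_of_isSmooth (F' := ℝ) (d := d) hd
  have hK0 : (0 : ℝ) ≤ K := NNReal.coe_nonneg K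
  refine ⟨(K : ℝ) * (Fintype.card d : ℝ) ^ 3, by positivity, fun f hf => ?_⟩
  have hfc : Continuous f := hf.continuous
  have hDc : Continuous (Torus.fderiv f) := Torus.continuous_fderiv_of_isSmooth hf
  have hPc : Continuous (fun x => ∑ k, Torus.partialDeriv k f x ^ 2) :=
    continuous_finsetSum _ fun k _ => ((hf.partialDeriv k).continuous).pow 2
  have h6 := hK f hf
  have conv : ∀ {g : UnitAddTorus d → ℝ} (_ : Continuous g) (_ : ∀ x, 0 ≤ g x) (k : ℕ),
      ∫⁻ x, (ENNReal.ofReal (g x)) ^ k = ENNReal.ofReal (∫ x, g x ^ k) := by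
    intro g hg hg0 k
    have hi : Integrable (fun x => g x ^ k) volume := (hg.pow k).integrable_unitAddTorus
    rw [ofReal_integral_eq_lintegral_ofReal hi (ae_of_all _ fun x => pow_nonneg (hg0 x) k)]
    exact lintegral_congr fun x => (ENNReal.ofReal_pow (hg0 x) k).symm
  -- rewrite `‖f x‖ ^ 6 = f x ^ 6` inside the integrals
  have e6': ∫ x, ‖f x‖ ^ 6 = ∫ x, f x ^ 6 :=
    integral_congr_ae (ae_of_all _ fun x => by
      show ‖f x‖ ^ 6 = f x ^ 6
      rw [Real.norm_eq_abs, show (6 : ℕ) = 2 * 3 by norm_num, pow_mul, pow_mul, sq_abs])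
  have e2' : ∫ x, ‖f x‖ ^ 2 = ∫ x, f x ^ 2 :=
    integral_congr_ae (ae_of_all _ fun x => by
      show ‖f x‖ ^ 2 = f x ^ 2
      rw [Real.norm_eq_abs, sq_abs])
  have E6 : ∫⁻ x, ‖f x‖ₑ ^ 6 = ENNReal.ofReal (∫ x, ‖f x‖ ^ 6) := by
    rw [← conv hfc.norm (fun x => norm_nonneg _) 6]
    exact lintegral_congr fun x => by rw [ofReal_norm]
  have E2 : ∫⁻ x, ‖f x‖ₑ ^ 2 = ENNReal.ofReal (∫ x, ‖f x‖ ^ 2) := by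
    rw [← conv hfc.norm (fun x => norm_nonneg _) 2]
    exact lintegral_congr fun x => by rw [ofReal_norm]
  have ED : ∫⁻ x, ‖Torus.fderiv f x‖ₑ ^ 2 = ENNReal.ofReal (∫ x, ‖Torus.fderiv f x‖ ^ 2) := by
    rw [← conv hDc.norm (fun x => norm_nonneg _) 2]
    exact lintegral_congr fun x => by rw [ofReal_norm]
  have hA0 : 0 ≤ ∫ x, ‖f x‖ ^ 2 := integral_nonneg fun x => sq_nonneg _
  have hB0 : 0 ≤ ∫ x, ‖Torus.fderiv f x‖ ^ 2 := integral_nonneg fun x => sq_nonneg _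
  rw [E6, E2, ED, ← ENNReal.ofReal_add hA0 hB0, ← ENNReal.ofReal_pow (by positivity),
    ← ENNReal.ofReal_coe_nnreal, ← ENNReal.ofReal_mul hK0] at h6
  have h6' : ∫ x, ‖f x‖ ^ 6 ≤ K * ((∫ x, ‖f x‖ ^ 2) + ∫ x, ‖Torus.fderiv f x‖ ^ 2) ^ 3 :=
    (ENNReal.ofReal_le_ofReal_iff (by positivity)).1 h6
  rw [e6', e2'] at h6'
  -- `∫‖Df‖² ≤ d ∫∑ₖ(∂ₖf)²`
  have hDf : ∫ x, ‖Torus.fderiv f x‖ ^ 2 ≤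
      Fintype.card d * ∫ x, ∑ k, Torus.partialDeriv k f x ^ 2 := by
    rw [← integral_const_mul]
    refine integral_mono (hDc.norm.pow 2).integrable_unitAddTorus
      (hPc.integrable_unitAddTorus.const_mul _) fun x => ?_
    have h1 := Torus.norm_fderiv_sq_le_card_mul_sum (hf.isContDiff (by simp)) x
    have e : ∑ i, ‖Torus.partialDeriv i f x‖ ^ 2 = ∑ k, Torus.partialDeriv k f x ^ 2 :=
      Finset.sum_congr rfl fun k _ => by rw [Real.norm_eq_abs, sq_abs]
    simpa [e] using h1
  have hP0 : 0 ≤ ∫ x, ∑ k, Torus.partialDeriv k f x ^ 2 :=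
    integral_nonneg fun x => Finset.sum_nonneg fun k _ => sq_nonneg _
  have hF0 : 0 ≤ ∫ x, f x ^ 2 := integral_nonneg fun x => sq_nonneg _
  have hd1 : (1 : ℝ) ≤ Fintype.card d := by rw [hd]; norm_num
  calc ∫ x, f x ^ 6 ≤ K * ((∫ x, f x ^ 2) + ∫ x, ‖Torus.fderiv f x‖ ^ 2) ^ 3 := h6'
    _ ≤ K * ((Fintype.card d : ℝ) * ((∫ x, f x ^ 2) + ∫ x, ∑ k, Torus.partialDeriv k f x ^ 2)) ^ 3 := by
        gcongr
        calc (∫ x, f x ^ 2) + ∫ x, ‖Torus.fderiv f x‖ ^ 2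
            ≤ (∫ x, f x ^ 2) + Fintype.card d * ∫ x, ∑ k, Torus.partialDeriv k f x ^ 2 := by
              linarith [hDf]
          _ ≤ (Fintype.card d : ℝ) * (∫ x, f x ^ 2) +
              Fintype.card d * ∫ x, ∑ k, Torus.partialDeriv k f x ^ 2 := by
              nlinarith
          _ = (Fintype.card d : ℝ) * ((∫ x, f x ^ 2) + ∫ x, ∑ k, Torus.partialDeriv k f x ^ 2) := by
              ring
    _ = K * (Fintype.card d : ℝ) ^ 3 *
        ((∫ x, f x ^ 2) + ∫ x, ∑ k, Torus.partialDeriv k f x ^ 2) ^ 3 := by ring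

/-! ### §1 The kinematic identity (3): `|u| div(u/|u|) = −⟪u, (u·∇)u⟫/|u|²` -/

/-- **Vasseur's identity (3)** ("the main point of this modest paper is the following
straightforward equality coming from the incompressibility of the flow:
`|u| div(u/|u|) = −(u/|u|)·∇|u|` … `= −(uᵀ/|u|²)·∇u·u`"), on `T^d`: for a `C¹` vector field `v`
and a point `x` with `div v(x) = 0` and `v(x) ≠ 0`,
`|v(x)| · div(v/|v|)(x) = −⟪v(x), (v·∇)v(x)⟫ / |v(x)|²`
(`(v·∇)v = Torus.convect v v`; the field `v/|v| = |v|⁻¹ • v` with Lean's junk value `0` on the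
zero set, irrelevant at `x`). [cite: Vasseur2009, eq. (3) (p. 2)] -/
theorem norm_mul_divergence_dir_eq {v : UnitAddTorus d → EuclideanSpace ℝ d}
    (hv : Torus.IsContDiff 1 v) {x : UnitAddTorus d} (hdiv : Torus.divergence v x = 0)
    (hx : v x ≠ 0) :
    ‖v x‖ * Torus.divergence (fun y => ‖v y‖⁻¹ • v y) x =
      -(⟪v x, Torus.convect v v x⟫ / ‖v x‖ ^ 2) := by
  have hn : 0 < ‖v x‖ := norm_pos_iff.2 hx
  have hn2 : (‖v x‖ ^ 2 : ℝ) ≠ 0 := by positivity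
  -- the normalising weight as a real power of `‖v‖²` (junk values agree on the zero set)
  have hw : ∀ y, ‖v y‖⁻¹ = (‖v y‖ ^ 2) ^ (-(1 / 2 : ℝ)) := by
    intro y
    by_cases hy : v y = 0
    · simp [hy]
    · have hpos : 0 < ‖v y‖ := norm_pos_iff.2 hy
      rw [Real.rpow_neg (sq_nonneg _), ← Real.sqrt_eq_rpow, Real.sqrt_sq hpos.le]
  -- partial derivatives of the coordinates of `‖v‖⁻¹ • v` at `x`
  have key : ∀ i, Torus.partialDeriv i (fun y => (‖v y‖⁻¹ • v y) i) x =
      ‖v x‖⁻¹ * Torus.partialDeriv i v x i -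
        (‖v x‖ ^ 2) ^ (-(3 / 2 : ℝ)) * ⟪v x, Torus.partialDeriv i v x⟫ * v x i := by
    intro i
    set e : EuclideanSpace ℝ d := EuclideanSpace.single i 1 with he
    set φ : ℝ → EuclideanSpace ℝ d := fun s => v (x + Torus.proj (s • e)) with hφdef
    have hφ : HasDerivAt φ (Torus.partialDeriv i v x) 0 := by
      have h1 := Torus.hasDerivAt_comp_add_proj_smul hv x e 0
      simpa [hφdef, Torus.partialDeriv] using h1
    have hφ0 : φ 0 = v x := by simp [hφdef]
    -- the squared norm and its power `−1/2` along the line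
    have hN : HasDerivAt (fun s => ‖φ s‖ ^ 2) (2 * ⟪φ 0, Torus.partialDeriv i v x⟫) 0 := hφ.norm_sq
    have hN0 : ‖φ 0‖ ^ 2 ≠ 0 := by rw [hφ0]; exact hn2
    have hW : HasDerivAt (fun s => (‖φ s‖ ^ 2) ^ (-(1 / 2 : ℝ)))
        (2 * ⟪φ 0, Torus.partialDeriv i v x⟫ * (-(1 / 2 : ℝ)) *
          (‖φ 0‖ ^ 2) ^ (-(1 / 2 : ℝ) - 1)) 0 := hN.rpow_const (Or.inl hN0)
    -- the coordinate `i` along the line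
    have hC : HasDerivAt (fun s => φ s i) (Torus.partialDeriv i v x i) 0 :=
      (EuclideanSpace.proj i : EuclideanSpace ℝ d →L[ℝ] ℝ).hasFDerivAt.comp_hasDerivAt (0 : ℝ) hφ
    have hprod : HasDerivAt (fun s => (‖φ s‖ ^ 2) ^ (-(1 / 2 : ℝ)) * φ s i)
        (2 * ⟪φ 0, Torus.partialDeriv i v x⟫ * (-(1 / 2 : ℝ)) *
            (‖φ 0‖ ^ 2) ^ (-(1 / 2 : ℝ) - 1) * φ 0 i +
          (‖φ 0‖ ^ 2) ^ (-(1 / 2 : ℝ)) * Torus.partialDeriv i v x i) 0 := hW.mul hC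
    -- identify the partial derivative with the derivative along the line
    have e1 : (fun y => (‖v y‖⁻¹ • v y) i) = fun y => (‖v y‖ ^ 2) ^ (-(1 / 2 : ℝ)) * v y i := by
      funext y
      rw [PiLp.smul_apply, smul_eq_mul, hw y]
    rw [e1]
    show deriv (fun t : ℝ => (‖φ t‖ ^ 2) ^ (-(1 / 2 : ℝ)) * φ t i) 0 = _
    rw [hprod.deriv, hφ0]
    have e2 : (‖v x‖ ^ 2) ^ (-(1 / 2 : ℝ) - 1) = (‖v x‖ ^ 2) ^ (-(3 / 2 : ℝ)) := by norm_num
    rw [e2, ← hw x]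
    ring
  -- sum over `i`
  have hsum : Torus.divergence (fun y => ‖v y‖⁻¹ • v y) x =
      ‖v x‖⁻¹ * Torus.divergence v x -
        (‖v x‖ ^ 2) ^ (-(3 / 2 : ℝ)) * ⟪v x, Torus.convect v v x⟫ := by
    unfold Torus.divergence
    simp_rw [key]
    rw [Finset.sum_sub_distrib, ← Finset.mul_sum]
    congr 1
    · refine congr_arg _ (Finset.sum_congr rfl fun i _ => ?_)
      rw [Torus.partialDeriv_apply_coord hv]
    · have hc : Torus.convect v v x = ∑ i, v x i • Torus.partialDeriv i v x :=
        Torus.fderiv_apply_eq_sum_partialDeriv hv x (v x)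
      rw [hc, inner_sum, Finset.mul_sum]
      refine Finset.sum_congr rfl fun i _ => ?_
      rw [real_inner_smul_right]
      ring
  rw [hsum, hdiv, mul_zero, zero_sub, mul_neg, neg_inj]
  have e3 : (‖v x‖ ^ 2) ^ (-(3 / 2 : ℝ)) = (‖v x‖ ^ 3)⁻¹ := by
    rw [Real.rpow_neg (sq_nonneg _), ← Real.rpow_natCast, ← Real.rpow_mul (norm_nonneg _)]
    norm_num
  rw [e3]
  field_simp

/-- The quotient-free form of the hypothesis used below is the printed one: at a point where
`v ≠ 0` (and `div v = 0`), `|⟪v, (v·∇)v⟫| ≤ |v|² D ↔ ||v| div(v/|v|)| ≤ D`; at a zero of `v` the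
left-hand side holds for every `D ≥ 0`. [cite: Vasseur2009, eq. (3) (p. 2)] -/
theorem abs_norm_mul_divergence_dir_le_iff {v : UnitAddTorus d → EuclideanSpace ℝ d}
    (hv : Torus.IsContDiff 1 v) {x : UnitAddTorus d} (hdiv : Torus.divergence v x = 0)
    (hx : v x ≠ 0) (D : ℝ) :
    |‖v x‖ * Torus.divergence (fun y => ‖v y‖⁻¹ • v y) x| ≤ D ↔
      |⟪v x, Torus.convect v v x⟫| ≤ ‖v x‖ ^ 2 * D := by
  have hn : 0 < ‖v x‖ := norm_pos_iff.2 hx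
  have hn2 : 0 < ‖v x‖ ^ 2 := by positivity
  rw [norm_mul_divergence_dir_eq hv hdiv hx, abs_neg, abs_div, abs_of_pos hn2,
    div_le_iff₀ hn2, mul_comm]

/-! ### §1b The identity (3) in the `ℝⁿ` currency of the summit statement -/

section RealSpace

variable {E : Type*} [NormedAddCommGroup E] [InnerProductSpace ℝ E] [FiniteDimensional ℝ E]

/-- The trace of the rank-one map `y ↦ φ(y) • w` is `φ(w)`. [folklore] -/
private theorem trace_smulRight (φ : E →L[ℝ] ℝ) (w : E) :
    LinearMap.trace ℝ E ((φ.smulRight w : E →L[ℝ] E) : E →ₗ[ℝ] E) = φ w := by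
  classical
  let b := stdOrthonormalBasis ℝ E
  rw [LinearMap.trace_eq_sum_inner _ b]
  simp only [ContinuousLinearMap.coe_coe, ContinuousLinearMap.smulRight_apply, real_inner_smul_right]
  conv_rhs => rw [← b.sum_repr' w, map_sum]
  refine Finset.sum_congr rfl fun i _ => ?_
  rw [map_smul, smul_eq_mul, mul_comm]

/-- **Vasseur's identity (3), `ℝⁿ` form** (the vocabulary of the summit statement and of the door
S22 «SelfStrainDoor»: `NSWave0.divergence v x = tr Dv(x)`, self-strain `⟪v(x), Dv(x)v(x)⟫`): on a
finite-dimensional real inner product space, for `v` differentiable at `x` with `div v(x) = 0` and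
`v(x) ≠ 0`, `|v(x)| · div(v/|v|)(x) = −⟪v(x), Dv(x) v(x)⟫ / |v(x)|²`
("`|u| div(u/|u|) = −(u/|u|)·∇|u| = −(uᵀ/|u|²)·∇u·u`"; the field `v/|v| = |v|⁻¹ • v` with
Lean's junk value `0` on the zero set, irrelevant at `x`). [cite: Vasseur2009, eq. (3) (p. 2)] -/
theorem norm_mul_divergence_dir_eq_of_fderiv {v : E → E} {x : E} (hv : DifferentiableAt ℝ v x)
    (hdiv : NSWave0.divergence v x = 0) (hx : v x ≠ 0) :
    ‖v x‖ * NSWave0.divergence (fun y => ‖v y‖⁻¹ • v y) x =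
      -(⟪v x, fderiv ℝ v x (v x)⟫ / ‖v x‖ ^ 2) := by
  have hn : 0 < ‖v x‖ := norm_pos_iff.2 hx
  have hn2 : (‖v x‖ ^ 2 : ℝ) ≠ 0 := by positivity
  -- the normalising weight as a real power of `‖v‖²` (junk values agree on the zero set)
  have hw : ∀ y, ‖v y‖⁻¹ = (‖v y‖ ^ 2) ^ (-(1 / 2 : ℝ)) := by
    intro y
    by_cases hy : v y = 0
    · simp [hy]
    · have hpos : 0 < ‖v y‖ := norm_pos_iff.2 hy
      rw [Real.rpow_neg (sq_nonneg _), ← Real.sqrt_eq_rpow, Real.sqrt_sq hpos.le]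
  have e1 : (fun y => ‖v y‖⁻¹ • v y) = fun y => (‖v y‖ ^ 2) ^ (-(1 / 2 : ℝ)) • v y :=
    funext fun y => by rw [hw y]
  -- derivatives at `x`
  have hDv : HasFDerivAt v (fderiv ℝ v x) x := hv.hasFDerivAt
  have hN : HasFDerivAt (fun y => ‖v y‖ ^ 2) (2 • (innerSL ℝ (v x)).comp (fderiv ℝ v x)) x :=
    hDv.norm_sq
  have hA : HasFDerivAt (fun y => (‖v y‖ ^ 2) ^ (-(1 / 2 : ℝ)))
      ((-(1 / 2 : ℝ) * (‖v x‖ ^ 2) ^ (-(1 / 2 : ℝ) - 1)) •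
        (2 • (innerSL ℝ (v x)).comp (fderiv ℝ v x))) x :=
    hN.rpow_const (p := -(1 / 2 : ℝ)) (Or.inl hn2)
  have hF : HasFDerivAt (fun y => (‖v y‖ ^ 2) ^ (-(1 / 2 : ℝ)) • v y)
      ((‖v x‖ ^ 2) ^ (-(1 / 2 : ℝ)) • fderiv ℝ v x +
        ((-(1 / 2 : ℝ) * (‖v x‖ ^ 2) ^ (-(1 / 2 : ℝ) - 1)) •
          (2 • (innerSL ℝ (v x)).comp (fderiv ℝ v x))).smulRight (v x)) x :=
    hA.smul hDv
  unfold NSWave0.divergence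
  rw [e1, hF.fderiv]
  unfold NSWave0.divergence at hdiv
  rw [ContinuousLinearMap.toLinearMap_add, ContinuousLinearMap.toLinearMap_smul, map_add, map_smul,
    hdiv, smul_zero, zero_add, trace_smulRight]
  have hφ : ((-(1 / 2 : ℝ) * (‖v x‖ ^ 2) ^ (-(1 / 2 : ℝ) - 1)) •
      (2 • (innerSL ℝ (v x)).comp (fderiv ℝ v x))) (v x) =
      (-(1 / 2 : ℝ) * (‖v x‖ ^ 2) ^ (-(1 / 2 : ℝ) - 1)) * ((2 : ℕ) • ⟪v x, fderiv ℝ v x (v x)⟫) :=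
    rfl
  rw [hφ, nsmul_eq_mul, Nat.cast_ofNat]
  have e3 : (‖v x‖ ^ 2) ^ (-(1 / 2 : ℝ) - 1) = (‖v x‖ ^ 3)⁻¹ := by
    rw [show (-(1 / 2 : ℝ) - 1) = -(3 / 2 : ℝ) by norm_num, Real.rpow_neg (sq_nonneg _),
      ← Real.rpow_natCast, ← Real.rpow_mul (norm_nonneg _)]
    norm_num
  rw [e3]
  field_simp

/-- The quotient-free self-strain bound is the printed hypothesis, `ℝⁿ` form: at a point where
`v ≠ 0` and `div v = 0`, `|⟪v, Dv v⟫| ≤ |v|² D ↔ ||v| div(v/|v|)| ≤ D`. [cite: Vasseur2009, eq. (3) (p. 2)] -/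
theorem abs_norm_mul_divergence_dir_le_iff_of_fderiv {v : E → E} {x : E}
    (hv : DifferentiableAt ℝ v x) (hdiv : NSWave0.divergence v x = 0) (hx : v x ≠ 0) (D : ℝ) :
    |‖v x‖ * NSWave0.divergence (fun y => ‖v y‖⁻¹ • v y) x| ≤ D ↔
      |⟪v x, fderiv ℝ v x (v x)⟫| ≤ ‖v x‖ ^ 2 * D := by
  have hn : 0 < ‖v x‖ := norm_pos_iff.2 hx
  have hn2 : 0 < ‖v x‖ ^ 2 := by positivity
  rw [norm_mul_divergence_dir_eq_of_fderiv hv hdiv hx, abs_neg, abs_div, abs_of_pos hn2,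
    div_le_iff₀ hn2, mul_comm]

end RealSpace

/-! ### §2 The `L³`-type budget with the pressure term kept (proof of Thm 1, first display) -/

/-- Weighted AM–GM in the form used to absorb Lemma 2: for `0 < θ < 1`, `β ≥ 0`, `δ > 0`,
`X, Y ≥ 0`: `β X^θ Y^{1−θ} ≤ θ β^{1/θ} δ^{−(1−θ)/θ} X + (1 − θ) δ Y`
(`(c X)^θ (δ Y)^{1−θ} ≤ θ c X + (1−θ) δ Y` with `c = β^{1/θ} δ^{−(1−θ)/θ}`). [folklore] -/
private theorem amgm_split {θ β δ X Y : ℝ} (hθ0 : 0 < θ) (hθ1 : θ < 1) (hβ : 0 ≤ β)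
    (hδ : 0 < δ) (hX : 0 ≤ X) (hY : 0 ≤ Y) :
    β * (X ^ θ * Y ^ (1 - θ)) ≤
      θ * (β ^ (1 / θ) * δ ^ (-(1 - θ) / θ)) * X + (1 - θ) * δ * Y := by
  set c₁ : ℝ := β ^ (1 / θ) * δ ^ (-(1 - θ) / θ) with hc₁
  have hc₁0 : 0 ≤ c₁ := mul_nonneg (Real.rpow_nonneg hβ _) (Real.rpow_nonneg hδ.le _)
  have h := Real.geom_mean_le_arith_mean2_weighted hθ0.le (by linarith : 0 ≤ 1 - θ)
    (mul_nonneg hc₁0 hX) (mul_nonneg hδ.le hY) (by ring : θ + (1 - θ) = 1)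
  have hcθ : c₁ ^ θ * δ ^ (1 - θ) = β := by
    rw [hc₁, Real.mul_rpow (Real.rpow_nonneg hβ _) (Real.rpow_nonneg hδ.le _),
      ← Real.rpow_mul hβ, ← Real.rpow_mul hδ.le, one_div, inv_mul_cancel₀ hθ0.ne',
      Real.rpow_one, mul_assoc, ← Real.rpow_add hδ,
      show -(1 - θ) / θ * θ + (1 - θ) = 0 by field_simp; ring, Real.rpow_zero, mul_one]
  have e : (c₁ * X) ^ θ * (δ * Y) ^ (1 - θ) = β * (X ^ θ * Y ^ (1 - θ)) := by
    rw [Real.mul_rpow hc₁0 hX, Real.mul_rpow hδ.le hY]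
    calc c₁ ^ θ * X ^ θ * (δ ^ (1 - θ) * Y ^ (1 - θ))
        = c₁ ^ θ * δ ^ (1 - θ) * (X ^ θ * Y ^ (1 - θ)) := by ring
      _ = β * (X ^ θ * Y ^ (1 - θ)) := by rw [hcθ]
  rw [e] at h
  calc β * (X ^ θ * Y ^ (1 - θ)) ≤ θ * (c₁ * X) + (1 - θ) * (δ * Y) := h
    _ = θ * (β ^ (1 / θ) * δ ^ (-(1 - θ) / θ)) * X + (1 - θ) * δ * Y := by rw [hc₁]; ring

/-- **The exact `L³`-type balance with the pressure term kept.** Along a classical solution of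
the unforced Navier–Stokes equations (`ν > 0`) on `[a, b] × T^d`, at `t ∈ [a, b]`: if
`|⟪u, (u·∇)u⟫| ≤ |u|² D` pointwise at time `t` (`D ≥ 0` continuous), then
`F(s) = ∫ (|u(s)|² + 1)^{3/2}` has a one-sided derivative `R` within `[a, b]` at `t` with
`R ≤ −(4ν/3) ∫ ∑ₖ (∂ₖ (|u|² + 1)^{3/4})² + 3 ∫ |p − c| (|u|² + 1)^{1/2} D` for every constant `c` —
the printed "`d/dt∫|u|³/3 + ∫|u|(|∇u|² + |∇|u||²) − ∫P u·∇|u| = 0`" with the weight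
`w = (|u|² + 1)^{1/2}` in place of `|u|` (`3 w|∇w|² = (4/3)|∇w^{3/2}|²`), the term `∫ w|∇u|² ≥ 0`
dropped and `|P u·∇|u|| → |p − c| · |u|²w⁻¹ D ≤ |p − c| w D` by the hypothesis (the tree's exact
weighted balance `Torus.IsClassicalNSSolutionOn.hasDerivWithinAt_integral_comp_normSq` with
`Ψ(y) = (y + 1)^{3/2}`; `∑ₖ uₖ∂ₖ|u|² = 2⟪u, (u·∇)u⟫`). [cite: Vasseur2009, proof of Thm 1, first display p. 2] -/
theorem exists_hasDerivWithinAt_integral_le_of_selfStrain_le {a b ν : ℝ}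
    {u : ℝ → UnitAddTorus d → EuclideanSpace ℝ d} {p : ℝ → UnitAddTorus d → ℝ}
    (h : Torus.IsClassicalNSSolutionOn (Icc a b) ν 0 u p) (hν : 0 < ν) (hab : a < b) {t : ℝ}
    (ht : t ∈ Icc a b) {D : UnitAddTorus d → ℝ} (hDc : Continuous D) (hD0 : ∀ x, 0 ≤ D x)
    (hdom : ∀ x, |⟪u t x, Torus.convect (u t) (u t) x⟫| ≤ ‖u t x‖ ^ 2 * D x) (c : ℝ) :
    ∃ R : ℝ, HasDerivWithinAt (fun s => ∫ x, (‖u s x‖ ^ 2 + 1) ^ (3 / 2 : ℝ)) R (Icc a b) t ∧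
      R ≤ -(4 * ν / 3 *
          ∫ x, ∑ k, Torus.partialDeriv k (fun y => (‖u t y‖ ^ 2 + 1) ^ (3 / 4 : ℝ)) x ^ 2) +
        3 * ∫ x, |p t x - c| * (‖u t x‖ ^ 2 + 1) ^ (1 / 2 : ℝ) * D x := by
  set S : Set ℝ := Icc a b with hSdef
  set Ψ : ℝ → ℝ := fun y => (y + 1) ^ (3 / 2 : ℝ) with hΨdef
  have h32 : (1 : ℝ) ≤ 3 / 2 := by norm_num
  have hUo : IsOpen (Ioi (-1 : ℝ)) := isOpen_Ioi
  have hΨcd : ContDiffOn ℝ ∞ Ψ (Ioi (-1)) := by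
    refine (contDiffOn_id.add contDiffOn_const).rpow_const_of_ne fun y hy => ?_
    have : (-1 : ℝ) < y := hy
    simp only [id_eq]
    linarith
  have hmaps : ∀ s ∈ Icc a b, ∀ x, ‖u s x‖ ^ 2 ∈ Ioi (-1 : ℝ) := fun s _ x => by
    have := sq_nonneg ‖u s x‖
    show (-1 : ℝ) < ‖u s x‖ ^ 2
    linarith
  have hd1 : ∀ y, deriv Ψ y = 3 / 2 * (y + 1) ^ (3 / 2 - 1 : ℝ) := by
    intro y
    have := (((hasDerivAt_id' y).add_const (1 : ℝ)).rpow_const (p := 3 / 2) (Or.inr h32)).deriv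
    rw [this]
    ring
  have hd1' : deriv Ψ = fun y => 3 / 2 * (y + 1) ^ (3 / 2 - 1 : ℝ) := funext hd1
  have hd2 : ∀ y, -1 < y →
      deriv (deriv Ψ) y = 3 / 2 * (1 * (3 / 2 - 1 : ℝ) * (y + 1) ^ (3 / 2 - 1 - 1 : ℝ)) := by
    intro y hy
    rw [hd1']
    have hne : y + 1 ≠ 0 := by
      intro h0
      linarith
    exact ((((hasDerivAt_id' y).add_const (1 : ℝ)).rpow_const (p := 3 / 2 - 1)
      (Or.inl hne)).const_mul (3 / 2 : ℝ)).deriv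
  -- the exact balance for the solution `(u, p − c)`
  have h' := pressure_sub_const h c
  have hD := h'.hasDerivWithinAt_integral_comp_normSq hab hUo hΨcd hmaps ht
  refine ⟨_, hD, ?_⟩
  simp only [Pi.zero_apply, inner_zero_right, mul_zero, integral_zero, add_zero]
  -- notation and pointwise facts at time `t`
  have hut : Torus.IsSmooth (u t) := h.smooth_velocity.isSmooth_slice ht
  have hu1 : Torus.IsContDiff 1 (u t) := hut.isContDiff (by simp)
  have hpt : Torus.IsSmooth (p t) := h.smooth_pressure.isSmooth_slice ht
  have hQ1 : Torus.IsContDiff 1 (fun y => ‖u t y‖ ^ 2) := hu1.norm_sq ℝ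
  have hQs : Torus.IsSmooth (fun y => ‖u t y‖ ^ 2) := hut.norm_sq
  have hQpos : ∀ x, 0 < ‖u t x‖ ^ 2 + 1 := fun x => by
    have := sq_nonneg ‖u t x‖
    linarith
  have hQc : Continuous fun x => ‖u t x‖ ^ 2 + 1 := (hut.continuous.norm.pow 2).add continuous_const
  -- `∂ₖ|u|² = 2⟪u, ∂ₖu⟫`
  have e_dk : ∀ k x, Torus.partialDeriv k (fun y => ‖u t y‖ ^ 2) x =
      2 * ⟪u t x, Torus.partialDeriv k (u t) x⟫ := by
    intro k x
    rw [Torus.partialDeriv_eq_fderiv_apply hQ1, Torus.fderiv_norm_sq_apply hu1,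
      ← Torus.partialDeriv_eq_fderiv_apply hu1]
  -- `∑ₖ uₖ ∂ₖ|u|² = 2⟪u, (u·∇)u⟫`
  have e_sum : ∀ x, ∑ k, u t x k * Torus.partialDeriv k (fun y => ‖u t y‖ ^ 2) x =
      2 * ⟪u t x, Torus.convect (u t) (u t) x⟫ := by
    intro x
    have hc : Torus.convect (u t) (u t) x = ∑ i, u t x i • Torus.partialDeriv i (u t) x :=
      Torus.fderiv_apply_eq_sum_partialDeriv hu1 x (u t x)
    rw [hc, inner_sum, Finset.mul_sum]
    refine Finset.sum_congr rfl fun k _ => ?_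
    rw [e_dk, real_inner_smul_right]
    ring
  -- `∂ₖ (|u|² + 1)^{3/4} = (3/4)(|u|² + 1)^{−1/4} ∂ₖ|u|²`
  have e_f : ∀ k x, Torus.partialDeriv k (fun y => (‖u t y‖ ^ 2 + 1) ^ (3 / 4 : ℝ)) x =
      1 * (3 / 4 : ℝ) * (‖u t x‖ ^ 2 + 1) ^ (3 / 4 - 1 : ℝ) *
        Torus.partialDeriv k (fun y => ‖u t y‖ ^ 2) x := by
    intro k x
    have hg : HasDerivAt (fun y : ℝ => (y + 1) ^ (3 / 4 : ℝ))
        (1 * (3 / 4 : ℝ) * (‖u t x‖ ^ 2 + 1) ^ (3 / 4 - 1 : ℝ)) (‖u t x‖ ^ 2) :=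
      ((hasDerivAt_id' (‖u t x‖ ^ 2)).add_const (1 : ℝ)).rpow_const (p := 3 / 4)
        (Or.inl (hQpos x).ne')
    have h1 := partialDeriv_comp_deriv (g := fun y : ℝ => (y + 1) ^ (3 / 4 : ℝ))
      (θ := fun y => ‖u t y‖ ^ 2) hQ1 x hg.differentiableAt k
    rw [hg.deriv] at h1
    exact h1
  -- (i) the first viscous term is non-negative
  have hA₁ : 0 ≤ ∫ x, deriv Ψ (‖u t x‖ ^ 2) * ∑ k, ‖Torus.partialDeriv k (u t) x‖ ^ 2 := by
    refine integral_nonneg fun x => mul_nonneg ?_ (Finset.sum_nonneg fun k _ => sq_nonneg _)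
    rw [hd1]
    exact mul_nonneg (by norm_num) (Real.rpow_nonneg (hQpos x).le _)
  -- (ii) the second viscous term is `(4/3) ∫ |∇ (|u|²+1)^{3/4}|²`
  have hA₂ : ∫ x, deriv (deriv Ψ) (‖u t x‖ ^ 2) *
        ∑ k, Torus.partialDeriv k (fun y => ‖u t y‖ ^ 2) x ^ 2 =
      4 / 3 * ∫ x, ∑ k, Torus.partialDeriv k (fun y => (‖u t y‖ ^ 2 + 1) ^ (3 / 4 : ℝ)) x ^ 2 := by
    rw [← integral_const_mul]
    refine integral_congr_ae (ae_of_all _ fun x => ?_)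
    have hQ0 : 0 ≤ ‖u t x‖ ^ 2 + 1 := (hQpos x).le
    have epow : ((‖u t x‖ ^ 2 + 1) ^ (3 / 4 - 1 : ℝ)) ^ 2 =
        (‖u t x‖ ^ 2 + 1) ^ (3 / 2 - 1 - 1 : ℝ) := by
      rw [← Real.rpow_natCast, ← Real.rpow_mul hQ0]
      norm_num
    show deriv (deriv Ψ) (‖u t x‖ ^ 2) * ∑ k, Torus.partialDeriv k (fun y => ‖u t y‖ ^ 2) x ^ 2 =
      4 / 3 * ∑ k, Torus.partialDeriv k (fun y => (‖u t y‖ ^ 2 + 1) ^ (3 / 4 : ℝ)) x ^ 2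
    rw [hd2 _ (hmaps t ht x), Finset.mul_sum, Finset.mul_sum]
    refine Finset.sum_congr rfl fun k _ => ?_
    rw [e_f, show (1 * (3 / 4 : ℝ) * (‖u t x‖ ^ 2 + 1) ^ (3 / 4 - 1 : ℝ) *
        Torus.partialDeriv k (fun y => ‖u t y‖ ^ 2) x) ^ 2 =
      (3 / 4 : ℝ) ^ 2 * ((‖u t x‖ ^ 2 + 1) ^ (3 / 4 - 1 : ℝ)) ^ 2 *
        Torus.partialDeriv k (fun y => ‖u t y‖ ^ 2) x ^ 2 by ring, epow]
    ring
  -- (iii) the pressure term through the direction hypothesis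
  have hA₃ : ∫ x, (p t x - c) * (deriv (deriv Ψ) (‖u t x‖ ^ 2) *
        ∑ k, u t x k * Torus.partialDeriv k (fun y => ‖u t y‖ ^ 2) x) ≤
      3 / 2 * ∫ x, |p t x - c| * (‖u t x‖ ^ 2 + 1) ^ (1 / 2 : ℝ) * D x := by
    rw [← integral_const_mul]
    have hpt_le : ∀ x, (p t x - c) * (deriv (deriv Ψ) (‖u t x‖ ^ 2) *
        ∑ k, u t x k * Torus.partialDeriv k (fun y => ‖u t y‖ ^ 2) x) ≤
        3 / 2 * (|p t x - c| * (‖u t x‖ ^ 2 + 1) ^ (1 / 2 : ℝ) * D x) := by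
      intro x
      have hQ0 : 0 ≤ ‖u t x‖ ^ 2 + 1 := (hQpos x).le
      rw [hd2 _ (hmaps t ht x), e_sum]
      have ew : (‖u t x‖ ^ 2 + 1) ^ (3 / 2 - 1 - 1 : ℝ) * (‖u t x‖ ^ 2 + 1) =
          (‖u t x‖ ^ 2 + 1) ^ (1 / 2 : ℝ) := by
        rw [show (3 / 2 - 1 - 1 : ℝ) = 1 / 2 - 1 by norm_num, Real.rpow_sub_one (hQpos x).ne']
        field_simp
      have hW0 : 0 ≤ (‖u t x‖ ^ 2 + 1) ^ (3 / 2 - 1 - 1 : ℝ) := Real.rpow_nonneg hQ0 _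
      have hσ := hdom x
      have hle1 : (‖u t x‖ ^ 2 + 1) ^ (3 / 2 - 1 - 1 : ℝ) * ‖u t x‖ ^ 2 ≤
          (‖u t x‖ ^ 2 + 1) ^ (1 / 2 : ℝ) := by
        rw [← ew]
        exact mul_le_mul_of_nonneg_left (by linarith) hW0
      -- `z ≤ |z|` and the chain of pointwise bounds
      have habs : |(p t x - c) * (3 / 2 * (1 * (3 / 2 - 1 : ℝ) *
          (‖u t x‖ ^ 2 + 1) ^ (3 / 2 - 1 - 1 : ℝ)) * (2 * ⟪u t x, Torus.convect (u t) (u t) x⟫))| =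
          3 / 2 * (|p t x - c| * ((‖u t x‖ ^ 2 + 1) ^ (3 / 2 - 1 - 1 : ℝ) *
            |⟪u t x, Torus.convect (u t) (u t) x⟫|)) := by
        rw [show (p t x - c) * (3 / 2 * (1 * (3 / 2 - 1 : ℝ) *
            (‖u t x‖ ^ 2 + 1) ^ (3 / 2 - 1 - 1 : ℝ)) * (2 * ⟪u t x, Torus.convect (u t) (u t) x⟫)) =
            (3 / 2 : ℝ) * ((p t x - c) * ((‖u t x‖ ^ 2 + 1) ^ (3 / 2 - 1 - 1 : ℝ) *
              ⟪u t x, Torus.convect (u t) (u t) x⟫)) by ring,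
          abs_mul, abs_of_nonneg (by norm_num : (0 : ℝ) ≤ 3 / 2), abs_mul, abs_mul,
          abs_of_nonneg hW0]
      refine (le_abs_self _).trans ?_
      rw [habs]
      refine mul_le_mul_of_nonneg_left ?_ (by norm_num)
      calc |p t x - c| * ((‖u t x‖ ^ 2 + 1) ^ (3 / 2 - 1 - 1 : ℝ) *
            |⟪u t x, Torus.convect (u t) (u t) x⟫|)
          ≤ |p t x - c| * ((‖u t x‖ ^ 2 + 1) ^ (3 / 2 - 1 - 1 : ℝ) * (‖u t x‖ ^ 2 * D x)) :=
            mul_le_mul_of_nonneg_left (mul_le_mul_of_nonneg_left hσ hW0) (abs_nonneg _)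
        _ = |p t x - c| * ((‖u t x‖ ^ 2 + 1) ^ (3 / 2 - 1 - 1 : ℝ) * ‖u t x‖ ^ 2) * D x := by
            ring
        _ ≤ |p t x - c| * (‖u t x‖ ^ 2 + 1) ^ (1 / 2 : ℝ) * D x :=
            mul_le_mul_of_nonneg_right (mul_le_mul_of_nonneg_left hle1 (abs_nonneg _)) (hD0 x)
    have hrhs_int : Integrable (fun x => 3 / 2 * (|p t x - c| * (‖u t x‖ ^ 2 + 1) ^ (1 / 2 : ℝ) *
        D x)) volume :=
      ((((hpt.continuous.sub continuous_const).abs.mul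
        (hQc.rpow_const fun x => Or.inl (hQpos x).ne')).mul hDc).const_mul _).integrable_unitAddTorus
    by_cases hint : Integrable (fun x => (p t x - c) * (deriv (deriv Ψ) (‖u t x‖ ^ 2) *
        ∑ k, u t x k * Torus.partialDeriv k (fun y => ‖u t y‖ ^ 2) x)) volume
    · exact integral_mono hint hrhs_int hpt_le
    · rw [integral_undef hint]
      exact integral_nonneg fun x => mul_nonneg (by norm_num) (mul_nonneg (mul_nonneg
        (abs_nonneg _) (Real.rpow_nonneg (hQpos x).le _)) (hD0 x))
  -- assemble
  have hνA₁ : 0 ≤ ν * ∫ x, deriv Ψ (‖u t x‖ ^ 2) * ∑ k, ‖Torus.partialDeriv k (u t) x‖ ^ 2 :=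
    mul_nonneg hν.le hA₁
  rw [hA₂]
  nlinarith [hA₃, hνA₁, hν]

/-! ### §3 Hölder, the periodic Calderón–Zygmund bound and Lemma 2 -/

omit [DecidableEq d] in
/-- **The Hölder step of the printed proof** ("`∫|P||u||(u/|u|)·∇|u|| ≤ C‖u‖³_{L^{3r/2}}
‖|u| div(u/|u|)‖_{L^{q̄}}` with `2/r + 1/q̄ = 1`", combined with "`‖P‖_{L^{3r/4}} ≤ C_r‖u‖²_{L^{3r/2}}`"):
for continuous `A, D ≥ 0`, `Q > 0` on `T^d`, `1 < q`, `γ = 3q/(2(q−1))` (`= 3r/4`), a bound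
`‖A‖_{L^γ} ≤ C ‖Q‖_{L^γ}` and `‖D‖_{L^q} ≤ N` give
`∫ A Q^{1/2} D ≤ C (∫ Q^γ)^{(q−1)/q} N` (two Hölder inequalities with weights `((q−1)/q, 1/q)`
and `(2/3, 1/3)`). [cite: Vasseur2009, proof of Thm 1 (p. 3, the Hölder display)] -/
private theorem pressure_integral_le {q : ℝ} (hq : 1 < q) {A Q D : UnitAddTorus d → ℝ}
    (hA : Continuous A) (hQ : Continuous Q) (hD : Continuous D) (hA0 : ∀ x, 0 ≤ A x)
    (hQ0 : ∀ x, 0 < Q x) (hD0 : ∀ x, 0 ≤ D x) {C N : ℝ} (hC0 : 0 ≤ C)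
    (hcz : (∫ x, A x ^ (3 * q / (2 * (q - 1)))) ^ (1 / (3 * q / (2 * (q - 1)))) ≤
      C * (∫ x, Q x ^ (3 * q / (2 * (q - 1)))) ^ (1 / (3 * q / (2 * (q - 1)))))
    (hN : (∫ x, D x ^ q) ^ (1 / q) ≤ N) :
    ∫ x, A x * Q x ^ (1 / 2 : ℝ) * D x ≤
      C * (∫ x, Q x ^ (3 * q / (2 * (q - 1)))) ^ ((q - 1) / q) * N := by
  have hq0 : 0 < q := by linarith
  have hq1 : 0 < q - 1 := by linarith
  set γ : ℝ := 3 * q / (2 * (q - 1)) with hγ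
  set q' : ℝ := q / (q - 1) with hq'
  have hγ0 : 0 < γ := by rw [hγ]; positivity
  have hq'0 : 0 < q' := by rw [hq']; positivity
  have hγq' : γ = q' * (3 / 2) := by rw [hγ, hq']; field_simp
  have hQ0' : ∀ x, 0 ≤ Q x := fun x => (hQ0 x).le
  -- notation
  set M : ℝ := (∫ x, Q x ^ γ) ^ (1 / γ) with hM
  have hIQ0 : 0 ≤ ∫ x, Q x ^ γ := integral_nonneg fun x => Real.rpow_nonneg (hQ0' x) _
  have hM0 : 0 ≤ M := Real.rpow_nonneg hIQ0 _
  have hIQ : ∫ x, Q x ^ γ = M ^ γ := by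
    rw [hM, ← Real.rpow_mul hIQ0, one_div, inv_mul_cancel₀ hγ0.ne', Real.rpow_one]
  have hIA0 : 0 ≤ ∫ x, A x ^ γ := integral_nonneg fun x => Real.rpow_nonneg (hA0 x) _
  have hID0 : 0 ≤ ∫ x, D x ^ q := integral_nonneg fun x => Real.rpow_nonneg (hD0 x) _
  have hN0 : 0 ≤ N := le_trans (Real.rpow_nonneg hID0 _) hN
  -- `∫ A^γ ≤ (C M)^γ`
  have hAγ : ∫ x, A x ^ γ ≤ (C * M) ^ γ := by
    have h1 : (∫ x, A x ^ γ) ^ (1 / γ) ≤ C * M := hcz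
    calc ∫ x, A x ^ γ = ((∫ x, A x ^ γ) ^ (1 / γ)) ^ γ := by
          rw [← Real.rpow_mul hIA0, one_div, inv_mul_cancel₀ hγ0.ne', Real.rpow_one]
      _ ≤ (C * M) ^ γ := Real.rpow_le_rpow (Real.rpow_nonneg hIA0 _) h1 hγ0.le
  -- continuity facts
  have hBc : Continuous fun x => Q x ^ (1 / 2 : ℝ) := hQ.rpow_const fun x => Or.inl (hQ0 x).ne'
  have hB0 : ∀ x, 0 ≤ Q x ^ (1 / 2 : ℝ) := fun x => Real.rpow_nonneg (hQ0' x) _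
  have hABc : Continuous fun x => A x * Q x ^ (1 / 2 : ℝ) := hA.mul hBc
  have hAB0 : ∀ x, 0 ≤ A x * Q x ^ (1 / 2 : ℝ) := fun x => mul_nonneg (hA0 x) (hB0 x)
  -- Hölder 1: weights `((q−1)/q, 1/q)`
  have hw1 : 0 < (q - 1) / q := by positivity
  have hw2 : 0 < 1 / q := by positivity
  have hH1 := integral_mul_le_rpow_mul_rpow (f := fun x => A x * Q x ^ (1 / 2 : ℝ)) (g := D)
    hABc hD hAB0 hD0 hw1 hw2 (by field_simp; ring)
  have einv1 : ((q - 1) / q)⁻¹ = q' := by rw [hq', inv_div]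
  have einv2 : (1 / q : ℝ)⁻¹ = q := by rw [one_div, inv_inv]
  rw [einv1, einv2] at hH1
  -- Hölder 2: weights `(2/3, 1/3)` on `A^{q'} · B^{q'}`
  have hAq'c : Continuous fun x => A x ^ q' := hA.rpow_const fun x => Or.inr hq'0.le
  have hBq'c : Continuous fun x => (Q x ^ (1 / 2 : ℝ)) ^ q' :=
    hBc.rpow_const fun x => Or.inr hq'0.le
  have hH2 := integral_mul_le_rpow_mul_rpow (f := fun x => A x ^ q')
    (g := fun x => (Q x ^ (1 / 2 : ℝ)) ^ q') hAq'c hBq'c (fun x => Real.rpow_nonneg (hA0 x) _)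
    (fun x => Real.rpow_nonneg (hB0 x) _) (by norm_num : (0 : ℝ) < 2 / 3)
    (by norm_num : (0 : ℝ) < 1 / 3) (by norm_num)
  have eAB : ∀ x, (A x * Q x ^ (1 / 2 : ℝ)) ^ q' = A x ^ q' * (Q x ^ (1 / 2 : ℝ)) ^ q' :=
    fun x => Real.mul_rpow (hA0 x) (hB0 x)
  have eA : ∀ x, (A x ^ q') ^ (2 / 3 : ℝ)⁻¹ = A x ^ γ := fun x => by
    rw [← Real.rpow_mul (hA0 x), hγq']; norm_num
  have eB : ∀ x, ((Q x ^ (1 / 2 : ℝ)) ^ q') ^ (1 / 3 : ℝ)⁻¹ = Q x ^ γ := fun x => by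
    rw [← Real.rpow_mul (hQ0' x), ← Real.rpow_mul (hQ0' x), hγq']
    congr 1
    ring
  simp only [eA, eB] at hH2
  -- combine
  have hI2 : ∫ x, (A x * Q x ^ (1 / 2 : ℝ)) ^ q' ≤ C ^ q' * M ^ γ := by
    have e1 : ∫ x, (A x * Q x ^ (1 / 2 : ℝ)) ^ q' = ∫ x, A x ^ q' * (Q x ^ (1 / 2 : ℝ)) ^ q' :=
      integral_congr_ae (ae_of_all _ fun x => eAB x)
    rw [e1]
    refine hH2.trans ?_
    have h3 : (∫ x, A x ^ γ) ^ (2 / 3 : ℝ) ≤ ((C * M) ^ γ) ^ (2 / 3 : ℝ) :=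
      Real.rpow_le_rpow hIA0 hAγ (by norm_num)
    calc (∫ x, A x ^ γ) ^ (2 / 3 : ℝ) * (∫ x, Q x ^ γ) ^ (1 / 3 : ℝ)
        ≤ ((C * M) ^ γ) ^ (2 / 3 : ℝ) * (∫ x, Q x ^ γ) ^ (1 / 3 : ℝ) :=
          mul_le_mul_of_nonneg_right h3 (Real.rpow_nonneg hIQ0 _)
      _ = C ^ q' * M ^ γ := by
          rw [hIQ, ← Real.rpow_mul (mul_nonneg hC0 hM0), ← Real.rpow_mul hM0,
            Real.mul_rpow hC0 hM0, hγq']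
          rw [show q' * (3 / 2) * (2 / 3 : ℝ) = q' by ring, mul_assoc, ← Real.rpow_add' hM0]
          · congr 1; ring_nf
          · have : q' + q' * (3 / 2) * (1 / 3) = q' * (3 / 2) := by ring
            rw [this]; positivity
  have hI1 : (∫ x, (A x * Q x ^ (1 / 2 : ℝ)) ^ q') ^ ((q - 1) / q) ≤ C * M ^ (3 / 2 : ℝ) := by
    have hI20 : 0 ≤ ∫ x, (A x * Q x ^ (1 / 2 : ℝ)) ^ q' :=
      integral_nonneg fun x => Real.rpow_nonneg (hAB0 x) _
    calc (∫ x, (A x * Q x ^ (1 / 2 : ℝ)) ^ q') ^ ((q - 1) / q)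
        ≤ (C ^ q' * M ^ γ) ^ ((q - 1) / q) := Real.rpow_le_rpow hI20 hI2 hw1.le
      _ = C * M ^ (3 / 2 : ℝ) := by
          rw [Real.mul_rpow (Real.rpow_nonneg hC0 _) (Real.rpow_nonneg hM0 _),
            ← Real.rpow_mul hC0, ← Real.rpow_mul hM0, hq', hγ]
          rw [show q / (q - 1) * ((q - 1) / q) = 1 by field_simp,
            show 3 * q / (2 * (q - 1)) * ((q - 1) / q) = 3 / 2 by field_simp, Real.rpow_one]
  have eM : M ^ (3 / 2 : ℝ) = (∫ x, Q x ^ γ) ^ ((q - 1) / q) := by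
    rw [hM, ← Real.rpow_mul hIQ0, hγ]
    congr 1
    field_simp
  calc ∫ x, A x * Q x ^ (1 / 2 : ℝ) * D x
      ≤ (∫ x, (A x * Q x ^ (1 / 2 : ℝ)) ^ q') ^ ((q - 1) / q) * (∫ x, D x ^ q) ^ (1 / q) := hH1
    _ ≤ C * M ^ (3 / 2 : ℝ) * N :=
        mul_le_mul hI1 hN (Real.rpow_nonneg hID0 _) (mul_nonneg hC0 (Real.rpow_nonneg hM0 _))
    _ = C * (∫ x, Q x ^ γ) ^ ((q - 1) / q) * N := by rw [eM]

omit [DecidableEq d] in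
/-- **The interpolation half of Lemma 2** ("`β‖f‖²_{L^r} ≤ (β^{1/θ}‖f‖²_{L²})^θ (‖f‖²_{L⁶})^{1−θ}`,
`θ = 3/r − 1/2`", for `f = w^{3/2}`, `w = Q^{1/2}`): for continuous `Q > 0` on `T^d` and
`3/2 < q` (`r = 2q/(q−1) ∈ (2, 6)`, `θ = (2q−3)/(2q)`),
`(∫ Q^{3q/(2(q−1))})^{(q−1)/q} ≤ (∫ Q^{3/2})^θ ((∫ (Q^{3/4})⁶)^{1/3})^{1−θ}`
(the tree's `L²–L⁶` interpolation `Torus.integral_rpow_le_interpolate_two_six'`).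
[cite: Vasseur2009, Lemma 2 (proof, interpolation step)] -/
private theorem interp_le {q : ℝ} (hq : 3 / 2 < q) {Q : UnitAddTorus d → ℝ} (hQ : Continuous Q)
    (hQ0 : ∀ x, 0 < Q x) :
    (∫ x, Q x ^ (3 * q / (2 * (q - 1)))) ^ ((q - 1) / q) ≤
      (∫ x, Q x ^ (3 / 2 : ℝ)) ^ ((2 * q - 3) / (2 * q)) *
        ((∫ x, (Q x ^ (3 / 4 : ℝ)) ^ 6) ^ (1 / 3 : ℝ)) ^ (1 - (2 * q - 3) / (2 * q)) := by
  have hq0 : 0 < q := by linarith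
  have hq1 : 0 < q - 1 := by linarith
  set r : ℝ := 2 * q / (q - 1) with hr
  have hr2 : 2 < r := by rw [hr, lt_div_iff₀ hq1]; linarith
  have hr6 : r < 6 := by rw [hr, div_lt_iff₀ hq1]; linarith
  have hr0 : 0 < r := by linarith
  have hQ0' : ∀ x, 0 ≤ Q x := fun x => (hQ0 x).le
  set f : UnitAddTorus d → ℝ := fun x => Q x ^ (3 / 4 : ℝ) with hf
  have hfc : Continuous f := hQ.rpow_const fun x => Or.inl (hQ0 x).ne'
  have hf0 : ∀ x, 0 ≤ f x := fun x => Real.rpow_nonneg (hQ0' x) _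
  have hint := Torus.integral_rpow_le_interpolate_two_six' hr2 hr6 hfc hf0
  -- identify the powers of `f` with powers of `Q`
  have efr : ∀ x, f x ^ r = Q x ^ (3 * q / (2 * (q - 1))) := fun x => by
    rw [hf, ← Real.rpow_mul (hQ0' x), hr]
    congr 1
    field_simp
    ring
  have ef2 : ∀ x, f x ^ 2 = Q x ^ (3 / 2 : ℝ) := fun x => by
    show (Q x ^ (3 / 4 : ℝ)) ^ 2 = Q x ^ (3 / 2 : ℝ)
    rw [← Real.rpow_natCast, ← Real.rpow_mul (hQ0' x)]
    norm_num
  simp only [efr, ef2] at hint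
  have hI0 : 0 ≤ ∫ x, Q x ^ (3 * q / (2 * (q - 1))) :=
    integral_nonneg fun x => Real.rpow_nonneg (hQ0' x) _
  have hF0 : 0 ≤ ∫ x, Q x ^ (3 / 2 : ℝ) := integral_nonneg fun x => Real.rpow_nonneg (hQ0' x) _
  have h60 : 0 ≤ ∫ x, f x ^ 6 := integral_nonneg fun x => pow_nonneg (hf0 x) 6
  have hw : 0 ≤ (q - 1) / q := by positivity
  calc (∫ x, Q x ^ (3 * q / (2 * (q - 1)))) ^ ((q - 1) / q)
      ≤ ((∫ x, Q x ^ (3 / 2 : ℝ)) ^ ((6 - r) / 4) * (∫ x, f x ^ 6) ^ ((r - 2) / 4)) ^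
          ((q - 1) / q) := Real.rpow_le_rpow hI0 hint hw
    _ = (∫ x, Q x ^ (3 / 2 : ℝ)) ^ ((2 * q - 3) / (2 * q)) *
        ((∫ x, f x ^ 6) ^ (1 / 3 : ℝ)) ^ (1 - (2 * q - 3) / (2 * q)) := by
        rw [Real.mul_rpow (Real.rpow_nonneg hF0 _) (Real.rpow_nonneg h60 _),
          ← Real.rpow_mul hF0, ← Real.rpow_mul h60, ← Real.rpow_mul h60, hr]
        congr 2
        · field_simp
          ring
        · field_simp
          ring
set_option maxHeartbeats 400000 in -- buildfix (bf3-g27): 160k/180k FAIL, 200k PASS at accept time; line-neutral budget line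
/-- **The `L³`-type budget with Lemma 2 absorbed** (the printed chain "`≤ (9/16)‖|u|^{1/2}∇|u|‖²_{L²}
+ C‖|u| div(u/|u|)‖^{1/θ}_{L^{q̄}} ‖u‖³_{L³}`", `1/θ = 2q̄/(2q̄−3)`, with the weight
`w = (|u|² + 1)^{1/2}` in place of `|u|`): on `T^d`, `card d = 3`, for `ν > 0` and `3/2 < q < ∞`
there are `K₁, K₂ ≥ 0` such that along every classical solution of the unforced Navier–Stokes
equations on `[a, b] × T^d`, at every `t ∈ [a, b]`: if `|⟪u, (u·∇)u⟫| ≤ |u|² D` pointwise at time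
`t` with `D ≥ 0` continuous and `(∫ D^q)^{1/q} ≤ N`, then `F(s) = ∫ (|u(s)|² + 1)^{3/2}` has a
one-sided derivative `R` within `[a, b]` at `t` with
`R + (2ν/3) ∫ ∑ₖ (∂ₖ(|u|² + 1)^{3/4})² ≤ (K₁ N^{2q/(2q−3)} + K₂) F(t)`
(`exists_hasDerivWithinAt_integral_le_of_selfStrain_le`, the periodic Calderón–Zygmund bound
`Torus.exists_pressure_sub_average_Ls_le_normSq` at `γ = 3q/(2(q−1))`, two Hölder inequalities,
the `L²–L⁶` interpolation, the embedding `H¹(T³) ⊂ L⁶` and weighted AM–GM).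
[cite: Vasseur2009, proof of Thm 1 with Lemma 2 (pp. 2–3)] -/
theorem exists_deriv_le_of_selfStrain_le (hd : Fintype.card d = 3) {ν q : ℝ} (hν : 0 < ν)
    (hq : 3 / 2 < q) :
    ∃ K₁ K₂ : ℝ, 0 ≤ K₁ ∧ 0 ≤ K₂ ∧
      ∀ {a b : ℝ} {u : ℝ → UnitAddTorus d → EuclideanSpace ℝ d} {p : ℝ → UnitAddTorus d → ℝ},
        Torus.IsClassicalNSSolutionOn (Icc a b) ν 0 u p → a < b → ∀ {t : ℝ}, t ∈ Icc a b →
        ∀ {D : UnitAddTorus d → ℝ}, Continuous D → (∀ x, 0 ≤ D x) →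
          (∀ x, |⟪u t x, Torus.convect (u t) (u t) x⟫| ≤ ‖u t x‖ ^ 2 * D x) →
          ∀ {N : ℝ}, (∫ x, D x ^ q) ^ (1 / q) ≤ N →
            ∃ R : ℝ, HasDerivWithinAt (fun s => ∫ x, (‖u s x‖ ^ 2 + 1) ^ (3 / 2 : ℝ)) R
                (Icc a b) t ∧
              R + 2 * ν / 3 * (∫ x, ∑ k, Torus.partialDeriv k
                  (fun y => (‖u t y‖ ^ 2 + 1) ^ (3 / 4 : ℝ)) x ^ 2) ≤
                (K₁ * N ^ (2 * q / (2 * q - 3)) + K₂) * ∫ x, (‖u t x‖ ^ 2 + 1) ^ (3 / 2 : ℝ) := by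
  haveI : Nonempty d := by rw [← Fintype.card_pos_iff, hd]; norm_num
  have hq0 : 0 < q := by linarith
  have hq1 : 0 < q - 1 := by linarith
  have hq1' : 1 < q := by linarith
  have h2q3 : 0 < 2 * q - 3 := by linarith
  -- exponents
  set γ : ℝ := 3 * q / (2 * (q - 1)) with hγ
  set θ : ℝ := (2 * q - 3) / (2 * q) with hθ
  have hγ1 : 1 < γ := by
    rw [hγ, lt_div_iff₀ (by positivity)]
    linarith
  have hγ0 : 0 < γ := by linarith
  have hθ0 : 0 < θ := by rw [hθ]; positivity
  have hθ1 : θ < 1 := by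
    rw [hθ, div_lt_one (by positivity)]
    linarith
  have h1θ : 0 < 1 - θ := by linarith
  have hθinv : 1 / θ = 2 * q / (2 * q - 3) := by rw [hθ]; field_simp
  -- constants
  obtain ⟨C, hC0, hC⟩ := Torus.exists_pressure_sub_average_Ls_le_normSq (d := d) (γ := γ) hγ1
  obtain ⟨K, hK0, hK⟩ := exists_integral_pow_six_le (d := d) hd
  set K' : ℝ := K ^ (1 / 3 : ℝ) + 1 with hK'
  have hK'0 : 0 < K' := by
    have := Real.rpow_nonneg hK0 (1 / 3 : ℝ)
    rw [hK']; linarith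
  set δ : ℝ := 2 * ν / (3 * (1 - θ) * K') with hδ
  have hδ0 : 0 < δ := by rw [hδ]; positivity
  have hδK : (1 - θ) * δ * K' = 2 * ν / 3 := by
    rw [hδ]; field_simp
  set K₁ : ℝ := θ * ((3 * C) ^ (1 / θ) * δ ^ (-(1 - θ) / θ)) with hK₁
  have hK₁0 : 0 ≤ K₁ :=
    mul_nonneg hθ0.le (mul_nonneg (Real.rpow_nonneg (by positivity) _) (Real.rpow_nonneg hδ0.le _))
  refine ⟨K₁, 2 * ν / 3, hK₁0, by positivity, ?_⟩
  intro a b u p h hab t ht D hDc hD0 hdom N hN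
  obtain ⟨R, hR, hRle⟩ :=
    exists_hasDerivWithinAt_integral_le_of_selfStrain_le h hν hab ht hDc hD0 hdom (∫ y, p t y)
  refine ⟨R, hR, ?_⟩
  -- notation at time `t`
  have hut : Torus.IsSmooth (u t) := h.smooth_velocity.isSmooth_slice ht
  have hpt : Torus.IsSmooth (p t) := h.smooth_pressure.isSmooth_slice ht
  have hQs : Torus.IsSmooth (fun y => ‖u t y‖ ^ 2 + 1) := hut.norm_sq.add (Torus.isSmooth_const _)
  have hQpos : ∀ x, 0 < ‖u t x‖ ^ 2 + 1 := fun x => by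
    have := sq_nonneg ‖u t x‖
    linarith
  have hQc : Continuous fun x => ‖u t x‖ ^ 2 + 1 := hQs.continuous
  set Q : UnitAddTorus d → ℝ := fun x => ‖u t x‖ ^ 2 + 1 with hQdef
  have hQ0' : ∀ x, 0 ≤ Q x := fun x => (hQpos x).le
  set F : ℝ := ∫ x, Q x ^ (3 / 2 : ℝ) with hFdef
  set G : ℝ := ∫ x, ∑ k, Torus.partialDeriv k (fun y => Q y ^ (3 / 4 : ℝ)) x ^ 2 with hGdef
  have hF0 : 0 ≤ F := integral_nonneg fun x => Real.rpow_nonneg (hQ0' x) _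
  have hG0 : 0 ≤ G := integral_nonneg fun x => Finset.sum_nonneg fun k _ => sq_nonneg _
  have hID0 : 0 ≤ ∫ x, D x ^ q := integral_nonneg fun x => Real.rpow_nonneg (hD0 x) _
  have hN0 : 0 ≤ N := le_trans (Real.rpow_nonneg hID0 _) hN
  -- Step 1: the pressure integral (Hölder ×2 + Calderón–Zygmund)
  have hcz : (∫ x, |p t x - ∫ y, p t y| ^ γ) ^ (1 / γ) ≤ C * (∫ x, Q x ^ γ) ^ (1 / γ) := by
    refine (hC hab h t ht).trans (mul_le_mul_of_nonneg_left ?_ hC0)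
    refine Real.rpow_le_rpow (integral_nonneg fun x => Real.rpow_nonneg (sq_nonneg _) _) ?_
      (by positivity)
    refine integral_mono_of_nonneg (ae_of_all _ fun x => Real.rpow_nonneg (sq_nonneg _) _)
      ((hQc.rpow_const fun x => Or.inl (hQpos x).ne').integrable_unitAddTorus)
      (ae_of_all _ fun x => ?_)
    exact Real.rpow_le_rpow (sq_nonneg _) (by simp [hQdef]) hγ0.le
  have hP : ∫ x, |p t x - ∫ y, p t y| * Q x ^ (1 / 2 : ℝ) * D x ≤
      C * (∫ x, Q x ^ γ) ^ ((q - 1) / q) * N :=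
    pressure_integral_le hq1' (hpt.continuous.sub continuous_const).abs hQc hDc
      (fun x => abs_nonneg _) hQpos hD0 hC0 hcz hN
  -- Step 2: interpolation
  have hI := interp_le hq hQc hQpos
  -- Step 3: Sobolev for `f = Q^{3/4}`
  have hfs : Torus.IsSmooth (fun x => Q x ^ (3 / 4 : ℝ)) :=
    ContDiff.rpow_const_of_ne hQs fun v => (hQpos _).ne'
  have ef2 : ∀ x, (Q x ^ (3 / 4 : ℝ)) ^ 2 = Q x ^ (3 / 2 : ℝ) := fun x => by
    rw [← Real.rpow_natCast, ← Real.rpow_mul (hQ0' x)]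
    norm_num
  have h6 := hK _ hfs
  simp only [ef2] at h6
  have h60 : 0 ≤ ∫ x, (Q x ^ (3 / 4 : ℝ)) ^ 6 :=
    integral_nonneg fun x => pow_nonneg (Real.rpow_nonneg (hQ0' x) _) 6
  have hY : (∫ x, (Q x ^ (3 / 4 : ℝ)) ^ 6) ^ (1 / 3 : ℝ) ≤ K' * (F + G) := by
    have hFG : 0 ≤ F + G := add_nonneg hF0 hG0
    calc (∫ x, (Q x ^ (3 / 4 : ℝ)) ^ 6) ^ (1 / 3 : ℝ)
        ≤ (K * (F + G) ^ 3) ^ (1 / 3 : ℝ) := Real.rpow_le_rpow h60 h6 (by norm_num)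
      _ = K ^ (1 / 3 : ℝ) * (F + G) := by
          rw [Real.mul_rpow hK0 (pow_nonneg hFG 3), ← Real.rpow_natCast,
            ← Real.rpow_mul hFG]
          norm_num
      _ ≤ K' * (F + G) := by
          refine mul_le_mul_of_nonneg_right ?_ hFG
          rw [hK']; linarith
  -- Step 4: assemble with weighted AM–GM
  have hX2 : (∫ x, Q x ^ γ) ^ ((q - 1) / q) ≤ F ^ θ * (K' * (F + G)) ^ (1 - θ) := by
    refine hI.trans (mul_le_mul_of_nonneg_left ?_ (Real.rpow_nonneg hF0 _))
    exact Real.rpow_le_rpow (Real.rpow_nonneg h60 _) hY h1θ.le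
  have hβ0 : 0 ≤ 3 * C * N := by positivity
  have hAM := amgm_split hθ0 hθ1 hβ0 hδ0 hF0 (mul_nonneg hK'0.le (add_nonneg hF0 hG0))
    (Y := K' * (F + G))
  have eβ : (3 * C * N) ^ (1 / θ) = (3 * C) ^ (1 / θ) * N ^ (2 * q / (2 * q - 3)) := by
    rw [Real.mul_rpow (by positivity) hN0, hθinv]
  have h3P : 3 * ∫ x, |p t x - ∫ y, p t y| * Q x ^ (1 / 2 : ℝ) * D x ≤
      K₁ * N ^ (2 * q / (2 * q - 3)) * F + 2 * ν / 3 * F + 2 * ν / 3 * G := by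
    calc 3 * ∫ x, |p t x - ∫ y, p t y| * Q x ^ (1 / 2 : ℝ) * D x
        ≤ 3 * (C * (∫ x, Q x ^ γ) ^ ((q - 1) / q) * N) := by linarith [hP]
      _ = 3 * C * N * (∫ x, Q x ^ γ) ^ ((q - 1) / q) := by ring
      _ ≤ 3 * C * N * (F ^ θ * (K' * (F + G)) ^ (1 - θ)) := mul_le_mul_of_nonneg_left hX2 hβ0
      _ ≤ θ * ((3 * C * N) ^ (1 / θ) * δ ^ (-(1 - θ) / θ)) * F +
          (1 - θ) * δ * (K' * (F + G)) := hAM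
      _ = K₁ * N ^ (2 * q / (2 * q - 3)) * F + 2 * ν / 3 * F + 2 * ν / 3 * G := by
          rw [eβ, show (1 - θ) * δ * (K' * (F + G)) = (1 - θ) * δ * K' * (F + G) by ring, hδK,
            hK₁]
          ring
  -- conclusion
  have hRle' : R ≤ -(4 * ν / 3 * G) + 3 * ∫ x, |p t x - ∫ y, p t y| * Q x ^ (1 / 2 : ℝ) * D x :=
    hRle
  nlinarith [hRle', h3P, hF0, hG0, hK₁0, Real.rpow_nonneg hN0 (2 * q / (2 * q - 3))]

/-! ### §4 Grönwall with the dissipation kept; joint smoothness of the weights -/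

/-- Primitives of functions continuous on `[a, b]` are differentiable within `[a, b]`. [folklore] -/
private theorem hasDerivWithinAt_primitive {a b : ℝ} {k : ℝ → ℝ} (hk : ContinuousOn k (Icc a b))
    {s : ℝ} (hs : s ∈ Icc a b) :
    HasDerivWithinAt (fun r => ∫ τ in a..r, k τ) (k s) (Icc a b) s := by
  haveI : Fact (s ∈ Icc a b) := ⟨hs⟩
  have hint : IntervalIntegrable k volume a s :=
    (hk.mono (Icc_subset_Icc_right hs.2)).intervalIntegrable_of_Icc hs.1
  exact intervalIntegral.integral_hasDerivWithinAt_right hint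
    (hk.stronglyMeasurableAtFilter_nhdsWithin measurableSet_Icc s) (hk s hs)

/-- **Grönwall's inequality with a dissipation term kept** ("Gronwall argument gives
`lim_{t→T} ∫|u|³ < ∞`, and so `∫∫|u||∇|u||²` is finite too"): if `F' + c G ≤ m F` on `[0, t]` with
`F, G, m ≥ 0`, `G, m` continuous and `∫₀ᵗ m ≤ J`, then `F ≤ F(0) e^J` on `[0, t]` and
`c ∫₀ᵗ G ≤ F(0) (1 + J e^J)`. [cite: Vasseur2009, proof of Thm 1 (p. 3, the Grönwall step)] -/
private theorem gronwall_dissip {t c : ℝ} (h0t : 0 < t) (hc : 0 ≤ c) {F G m Fd : ℝ → ℝ}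
    (hF : ∀ s ∈ Icc 0 t, HasDerivWithinAt F (Fd s) (Icc 0 t) s)
    (hle : ∀ s ∈ Icc 0 t, Fd s + c * G s ≤ m s * F s)
    (hG : ContinuousOn G (Icc 0 t)) (hG0 : ∀ s ∈ Icc 0 t, 0 ≤ G s)
    (hm : ContinuousOn m (Icc 0 t)) (hm0 : ∀ s ∈ Icc 0 t, 0 ≤ m s)
    (hF0 : ∀ s ∈ Icc 0 t, 0 ≤ F s) {J : ℝ} (hJ : ∫ τ in (0 : ℝ)..t, m τ ≤ J) :
    (∀ s ∈ Icc 0 t, F s ≤ F 0 * Real.exp J) ∧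
      c * ∫ τ in (0 : ℝ)..t, G τ ≤ F 0 * (1 + J * Real.exp J) := by
  have hFc : ContinuousOn F (Icc 0 t) := fun s hs => (hF s hs).continuousWithinAt
  have hmi : IntervalIntegrable m volume 0 t := hm.intervalIntegrable_of_Icc h0t.le
  have hJ0 : 0 ≤ ∫ τ in (0 : ℝ)..t, m τ :=
    intervalIntegral.integral_nonneg h0t.le fun s hs => hm0 s hs
  -- (1) Grönwall
  have hle' : ∀ s ∈ Icc 0 t, Fd s ≤ m s * F s := fun s hs => by
    have := hle s hs
    have := mul_nonneg hc (hG0 s hs)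
    linarith
  have hgr : ∀ s ∈ Icc 0 t, F s ≤ F 0 * Real.exp J := by
    intro s hs
    have h1 := le_mul_exp_integral_of_hasDerivWithinAt_le_mul h0t hF hm hle' hs
    have h2 : ∫ τ in (0 : ℝ)..s, m τ ≤ J := by
      refine le_trans ?_ hJ
      exact intervalIntegral.integral_mono_interval le_rfl hs.1 hs.2
        (ae_restrict_of_forall_mem measurableSet_Ioc fun τ hτ => hm0 τ ⟨hτ.1.le, hτ.2⟩) hmi
    exact h1.trans (mul_le_mul_of_nonneg_left (Real.exp_le_exp.2 h2) (hF0 0 ⟨le_rfl, h0t.le⟩))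
  refine ⟨hgr, ?_⟩
  -- (2) the dissipation: `H = F + c ∫G − ∫ m F` is non-increasing
  have hmF : ContinuousOn (fun s => m s * F s) (Icc 0 t) := hm.mul hFc
  set H : ℝ → ℝ := fun s => F s + c * (∫ τ in (0 : ℝ)..s, G τ) - ∫ τ in (0 : ℝ)..s, m τ * F τ
    with hHdef
  set H' : ℝ → ℝ := fun s => Fd s + c * G s - m s * F s with hH'def
  have hH : ∀ s ∈ Icc 0 t, HasDerivWithinAt H (H' s) (Icc 0 t) s := fun s hs =>
    ((hF s hs).add ((hasDerivWithinAt_primitive hG hs).const_mul c)).sub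
      (hasDerivWithinAt_primitive hmF hs)
  have hH'le : ∀ s ∈ Icc 0 t, H' s ≤ 0 := fun s hs => by
    have := hle s hs
    show Fd s + c * G s - m s * F s ≤ 0
    linarith
  have hanti : AntitoneOn H (Icc 0 t) := by
    refine antitoneOn_of_hasDerivWithinAt_nonpos (convex_Icc 0 t)
      (fun s hs => (hH s hs).continuousWithinAt) (f' := H') ?_ ?_
    · intro s hs
      rw [interior_Icc] at hs ⊢
      exact (hH s (Ioo_subset_Icc_self hs)).mono Ioo_subset_Icc_self
    · intro s hs
      rw [interior_Icc] at hs
      exact hH'le s (Ioo_subset_Icc_self hs)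
  have hHt : H t ≤ H 0 := hanti ⟨le_rfl, h0t.le⟩ ⟨h0t.le, le_rfl⟩ h0t.le
  have hH0 : H 0 = F 0 := by
    simp [hHdef, intervalIntegral.integral_same]
  have hmFi : IntervalIntegrable (fun τ => m τ * F τ) volume 0 t :=
    hmF.intervalIntegrable_of_Icc h0t.le
  have hmB : ∫ τ in (0 : ℝ)..t, m τ * F τ ≤ ∫ τ in (0 : ℝ)..t, m τ * (F 0 * Real.exp J) :=
    intervalIntegral.integral_mono_on h0t.le hmFi (hmi.mul_const _)
      fun τ hτ => mul_le_mul_of_nonneg_left (hgr τ hτ) (hm0 τ hτ)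
  rw [intervalIntegral.integral_mul_const] at hmB
  have hFt : 0 ≤ F t := hF0 t ⟨h0t.le, le_rfl⟩
  have hHt' : F t + c * (∫ τ in (0 : ℝ)..t, G τ) - ∫ τ in (0 : ℝ)..t, m τ * F τ ≤ F 0 := by
    rw [← hH0]; exact hHt
  have hF00 : 0 ≤ F 0 := hF0 0 ⟨le_rfl, h0t.le⟩
  have hexp : 0 ≤ F 0 * Real.exp J := mul_nonneg hF00 (Real.exp_pos _).le
  nlinarith [hHt', hmB, mul_le_mul_of_nonneg_right hJ hexp, hJ0]

omit [DecidableEq d] in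
/-- `(s, x) ↦ |u(s, x)|² + 1` is jointly smooth. [folklore] -/
private theorem smooth_normSqAddOne {S : Set ℝ} {u : ℝ → UnitAddTorus d → EuclideanSpace ℝ d}
    (hu : Torus.IsSmoothSpaceTimeOn S u) :
    Torus.IsSmoothSpaceTimeOn S (fun s x => ‖u s x‖ ^ 2 + 1) := by
  have h1 : Torus.IsSmoothSpaceTimeOn S (fun s x => ⟪u s x, u s x⟫ + 1) :=
    (hu.inner hu).add (Torus.isSmoothSpaceTimeOn_const (Torus.isSmooth_const (1 : ℝ)) S)
  have e : (fun s x => ‖u s x‖ ^ 2 + 1) = fun s x => ⟪u s x, u s x⟫ + 1 := by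
    funext s x
    rw [real_inner_self_eq_norm_sq]
  rw [e]
  exact h1

omit [DecidableEq d] in
/-- `(s, x) ↦ (|u(s, x)|² + 1)^c` is jointly smooth. [folklore] -/
private theorem smooth_normSqAddOne_rpow {S : Set ℝ} {u : ℝ → UnitAddTorus d → EuclideanSpace ℝ d}
    (hu : Torus.IsSmoothSpaceTimeOn S u) (c : ℝ) :
    Torus.IsSmoothSpaceTimeOn S (fun s x => (‖u s x‖ ^ 2 + 1) ^ c) := by
  refine (smooth_normSqAddOne hu).comp_contDiffOn (g := fun y : ℝ => y ^ c) (U := Ioi 0) ?_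
    fun s _ x => ?_
  · exact fun y hy => (Real.contDiffAt_rpow_const_of_ne (p := c) (ne_of_gt hy)).contDiffWithinAt
  · have := sq_nonneg ‖u s x‖
    show (0 : ℝ) < ‖u s x‖ ^ 2 + 1
    linarith

/-- The integrand of the dissipation `∑ₖ (∂ₖ (|u|² + 1)^{3/4})²` is jointly smooth on
`[a, b] × T^d`. [folklore] -/
private theorem smooth_gradSq {a b : ℝ} {u : ℝ → UnitAddTorus d → EuclideanSpace ℝ d}
    (hu : Torus.IsSmoothSpaceTimeOn (Icc a b) u) (hab : a < b) :
    Torus.IsSmoothSpaceTimeOn (Icc a b)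
      (fun s x => ∑ k, Torus.partialDeriv k (fun y => (‖u s y‖ ^ 2 + 1) ^ (3 / 4 : ℝ)) x ^ 2) := by
  have hU : UniqueDiffOn ℝ (Icc a b) := uniqueDiffOn_Icc hab
  have hf := smooth_normSqAddOne_rpow hu (3 / 4 : ℝ)
  have h : ∀ k, Torus.IsSmoothSpaceTimeOn (Icc a b)
      (fun s x => Torus.partialDeriv k (fun y => (‖u s y‖ ^ 2 + 1) ^ (3 / 4 : ℝ)) x ^ 2) := by
    intro k
    have h1 := (hf.partialDeriv hU k).mul (hf.partialDeriv hU k)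
    have e : (fun s x => Torus.partialDeriv k (fun y => (‖u s y‖ ^ 2 + 1) ^ (3 / 4 : ℝ)) x ^ 2) =
        fun s x => Torus.partialDeriv k (fun y => (‖u s y‖ ^ 2 + 1) ^ (3 / 4 : ℝ)) x *
          Torus.partialDeriv k (fun y => (‖u s y‖ ^ 2 + 1) ^ (3 / 4 : ℝ)) x := by
      funext s x
      rw [sq]
    rw [e]
    exact h1
  exact Torus.IsSmoothSpaceTimeOn.sum (s := Finset.univ) fun k (_ : k ∈ Finset.univ) => h k

end Vasseur2009

/-! ### §5 The criterion (2) and Theorem 1 along classical solutions on `T³` -/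

section Criterion

variable {ν T : ℝ} {u : ℝ → UnitAddTorus d → EuclideanSpace ℝ d} {p : ℝ → UnitAddTorus d → ℝ}

open Vasseur2009 in
/-- **Vasseur's criterion (2) on `T³` (continuation form): `|u| div(u/|u|) ∈ L^γ(0,T; L^q)`,
`2/γ + 3/q ≤ 2`, prevents blow-up.** Printed (p. 3): "there exists `p̄ > 1` and `2 < q̄ < 6`
such that `|u| div(u/|u|) ∈ L^{p̄}(L^{q̄})` with … `2/p̄ + 3/q̄ ≤ 2` (2) … Gronwall argument
gives `lim_{t→T} ∫|u|³ < ∞`, and so `∫∫|u||∇|u||²` is finite too. Sobolev imbedding gives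
`u ∈ L³(t₀,T;L⁹)` which gives the desired contradiction [with Serrin's criterion]."
Here: a classical solution of the unforced Navier–Stokes equations (`ν > 0`) on `[0, T) × T^d`,
`card d = 3`, `T > 0`, with mean-zero velocity slices; a family `D(t) ≥ 0` of continuous
functions dominating the printed quantity quotient-free, `|⟪u(t), (u(t)·∇)u(t)⟫| ≤ |u(t)|² D(t)`
pointwise (`= ||u| div(u/|u|)|` off the zero set by the identity (3),
`Vasseur2009.abs_norm_mul_divergence_dir_le_iff`); `3/2 < q < ∞` and `γ > 0` with
`2/γ + 3/q ≤ 2`; a continuous majorant `N(t) ≥ (∫ D(t)^q)^{1/q}` on `[0, T)` with `∫₀ᵗ N^γ ≤ I`: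
then the solution continues to a classical solution with mean-zero slices on some `[0, T'] × T^d`,
`T' > T`, equal to `u` on `[0, T)`. Proof: `Vasseur2009.exists_deriv_le_of_selfStrain_le` and
Grönwall bound `sup_t ∫(|u|²+1)^{3/2}` and `∫₀ᵀ∫|∇(|u|²+1)^{3/4}|²`; the embedding
`H¹(T³) ⊂ L⁶` applied to `(|u|²+1)^{3/4}` bounds `∫₀ᵀ (∫|u|⁹)^{1/3}`; Serrin with `(s, r) = (9, 3)`
(`Torus.classicalNS_continuation_of_Ls_rpow_integral_le`). The printed range `2 ≤ q̄ < 6` is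
contained in the typed one. [cite: Vasseur2009, Thm 1 (proof) and eq. (2) (pp. 2–3)] -/
theorem Torus.classicalNS_continuation_of_selfStrain_Lq_rpow_integral_le (hd : Fintype.card d = 3)
    {q γ : ℝ} (hν : 0 < ν) (hT : 0 < T) (hq : 3 / 2 < q) (hγ : 0 < γ) (hγq : 2 / γ + 3 / q ≤ 2)
    (h : Torus.IsClassicalNSSolutionOn (Ico 0 T) ν 0 u p)
    (hmean : ∀ t ∈ Ico 0 T, Torus.HasZeroMean (u t)) {D : ℝ → UnitAddTorus d → ℝ}
    (hDc : ∀ t ∈ Ico 0 T, Continuous (D t)) (hD0 : ∀ t ∈ Ico 0 T, ∀ x, 0 ≤ D t x)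
    (hdom : ∀ t ∈ Ico 0 T, ∀ x, |⟪u t x, Torus.convect (u t) (u t) x⟫| ≤ ‖u t x‖ ^ 2 * D t x)
    {N : ℝ → ℝ} (hNc : ContinuousOn N (Ico 0 T))
    (hN : ∀ t ∈ Ico 0 T, (∫ x, D t x ^ q) ^ (1 / q) ≤ N t)
    {I : ℝ} (hI : ∀ t ∈ Ico 0 T, ∫ τ in (0 : ℝ)..t, N τ ^ γ ≤ I) :
    ∃ T' : ℝ, T < T' ∧ ∃ (u' : ℝ → UnitAddTorus d → EuclideanSpace ℝ d)
      (p' : ℝ → UnitAddTorus d → ℝ), Torus.IsClassicalNSSolutionOn (Icc 0 T') ν 0 u' p' ∧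
        (∀ t ∈ Icc 0 T', Torus.HasZeroMean (u' t)) ∧ ∀ t ∈ Ico 0 T, u' t = u t := by
  have hq0 : 0 < q := by linarith
  have h2q3 : 0 < 2 * q - 3 := by linarith
  set p₀ : ℝ := 2 * q / (2 * q - 3) with hp₀
  have hp₀0 : 0 < p₀ := by rw [hp₀]; positivity
  have hp₀γ : p₀ ≤ γ := by
    rw [hp₀, div_le_iff₀ h2q3]
    have h1 : 2 / γ ≤ 2 - 3 / q := by linarith
    rw [div_le_iff₀ hγ] at h1
    have h2 : (2 - 3 / q) * γ = (2 * q - 3) / q * γ := by field_simp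
    rw [h2] at h1
    have h3 := mul_le_mul_of_nonneg_left h1 hq0.le
    rw [show q * ((2 * q - 3) / q * γ) = γ * (2 * q - 3) by field_simp] at h3
    linarith
  -- constants
  obtain ⟨K₁, K₂, hK₁, hK₂, hstep⟩ := exists_deriv_le_of_selfStrain_le (d := d) hd hν hq
  obtain ⟨K, hK0, hK⟩ := exists_integral_pow_six_le (d := d) hd
  -- non-negativity of `N` and of `I`
  have hN0 : ∀ t ∈ Ico 0 T, 0 ≤ N t := fun t ht =>
    le_trans (Real.rpow_nonneg (integral_nonneg fun x => Real.rpow_nonneg (hD0 t ht x) _) _) (hN t ht)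
  have hI0 : 0 ≤ I := by
    have h0 := hI 0 ⟨le_rfl, hT⟩
    rwa [intervalIntegral.integral_same] at h0
  -- notation
  set F : ℝ → ℝ := fun s => ∫ x, (‖u s x‖ ^ 2 + 1) ^ (3 / 2 : ℝ) with hFdef
  set G : ℝ → ℝ := fun s => ∫ x, ∑ k, Torus.partialDeriv k
    (fun y => (‖u s y‖ ^ 2 + 1) ^ (3 / 4 : ℝ)) x ^ 2 with hGdef
  set m : ℝ → ℝ := fun s => K₁ * N s ^ p₀ + K₂ with hmdef
  set J : ℝ := K₁ * (T + I) + K₂ * T with hJdef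
  have hJ0 : 0 ≤ J := by positivity
  set B : ℝ := F 0 * Real.exp J with hBdef
  have hFnn : ∀ s, 0 ≤ F s := fun s => integral_nonneg fun x => Real.rpow_nonneg (by positivity) _
  have hGnn : ∀ s, 0 ≤ G s := fun s =>
    integral_nonneg fun x => Finset.sum_nonneg fun k _ => sq_nonneg _
  have hB0 : 0 ≤ B := mul_nonneg (hFnn 0) (Real.exp_pos _).le
  set Gb : ℝ := 3 / (2 * ν) * (F 0 * (1 + J * Real.exp J)) with hGbdef
  -- `N^{p₀} ≤ 1 + N^γ`
  have hNp : ∀ t ∈ Ico 0 T, N t ^ p₀ ≤ 1 + N t ^ γ := by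
    intro t ht
    rcases le_or_gt (N t) 1 with h1 | h1
    · have := Real.rpow_le_one (hN0 t ht) h1 hp₀0.le
      linarith [Real.rpow_nonneg (hN0 t ht) γ]
    · have := Real.rpow_le_rpow_of_exponent_le h1.le hp₀γ
      linarith
  -- the window bounds on `[0, t]`
  have hwin : ∀ t ∈ Ico 0 T, 0 < t →
      (∀ s ∈ Icc 0 t, F s ≤ B) ∧ (∫ τ in (0 : ℝ)..t, G τ ≤ Gb) ∧ ContinuousOn G (Icc 0 t) := by
    intro t ht h0t
    have hsub : Icc 0 t ⊆ Ico 0 T := fun s hs => ⟨hs.1, hs.2.trans_lt ht.2⟩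
    have h' : Torus.IsClassicalNSSolutionOn (Icc 0 t) ν 0 u p :=
      h.mono hsub (uniqueDiffOn_Icc h0t)
    -- derivatives and the differential inequality
    have hder : ∀ s ∈ Icc 0 t, ∃ R : ℝ, HasDerivWithinAt F R (Icc 0 t) s ∧
        R + 2 * ν / 3 * G s ≤ m s * F s := by
      intro s hs
      obtain ⟨R, hR, hRle⟩ := hstep h' h0t hs (hDc s (hsub hs)) (hD0 s (hsub hs))
        (hdom s (hsub hs)) (hN s (hsub hs))
      exact ⟨R, hR, hRle⟩
    choose! Fd hFd hFle using hder
    -- continuity of `G` and `m`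
    have hGc : ContinuousOn G (Icc 0 t) :=
      (smooth_gradSq h'.smooth_velocity h0t).continuousOn_integral (convex_Icc 0 t)
    have hmc : ContinuousOn m (Icc 0 t) := by
      refine (continuousOn_const.mul ((hNc.mono hsub).rpow_const fun s hs =>
        Or.inr hp₀0.le)).add continuousOn_const
    have hm0 : ∀ s ∈ Icc 0 t, 0 ≤ m s := fun s hs =>
      add_nonneg (mul_nonneg hK₁ (Real.rpow_nonneg (hN0 s (hsub hs)) _)) hK₂
    -- `∫₀ᵗ m ≤ J`
    have hmi : IntervalIntegrable m volume 0 t := hmc.intervalIntegrable_of_Icc h0t.le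
    have hNγc : ContinuousOn (fun s => N s ^ γ) (Icc 0 t) :=
      (hNc.mono hsub).rpow_const fun s hs => Or.inr hγ.le
    have hmJ : ∫ τ in (0 : ℝ)..t, m τ ≤ J := by
      have hi1 : IntervalIntegrable (fun τ => N τ ^ γ) volume 0 t :=
        hNγc.intervalIntegrable_of_Icc h0t.le
      have h1 : ∫ τ in (0 : ℝ)..t, m τ ≤ ∫ τ in (0 : ℝ)..t, ((K₁ + K₂) + K₁ * N τ ^ γ) :=
        intervalIntegral.integral_mono_on h0t.le hmi
          (intervalIntegrable_const.add (hi1.const_mul K₁))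
          fun τ hτ => by
            show K₁ * N τ ^ p₀ + K₂ ≤ (K₁ + K₂) + K₁ * N τ ^ γ
            nlinarith [mul_le_mul_of_nonneg_left (hNp τ (hsub hτ)) hK₁]
      have h2 : ∫ τ in (0 : ℝ)..t, ((K₁ + K₂) + K₁ * N τ ^ γ) =
          (K₁ + K₂) * t + K₁ * ∫ τ in (0 : ℝ)..t, N τ ^ γ := by
        rw [intervalIntegral.integral_add (f := fun _ => K₁ + K₂) (g := fun τ => K₁ * N τ ^ γ)
            intervalIntegrable_const (hi1.const_mul K₁),
          intervalIntegral.integral_const, intervalIntegral.integral_const_mul, smul_eq_mul,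
          sub_zero]
        ring
      rw [h2] at h1
      have h3 : ∫ τ in (0 : ℝ)..t, N τ ^ γ ≤ I := hI t ht
      calc ∫ τ in (0 : ℝ)..t, m τ ≤ (K₁ + K₂) * t + K₁ * ∫ τ in (0 : ℝ)..t, N τ ^ γ := h1
        _ ≤ K₁ * (T + I) + K₂ * T := by
            have := mul_le_mul_of_nonneg_left h3 hK₁
            have := mul_le_mul_of_nonneg_left ht.2.le hK₂
            have := mul_le_mul_of_nonneg_left ht.2.le hK₁
            linarith
    have hgd := gronwall_dissip h0t (by positivity : (0 : ℝ) ≤ 2 * ν / 3) hFd hFle hGc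
      (fun s _ => hGnn s) hmc hm0 (fun s _ => hFnn s) hmJ
    refine ⟨fun s hs => hgd.1 s hs, ?_, hGc⟩
    have h2 := hgd.2
    rw [hGbdef]
    rw [show 3 / (2 * ν) * (F 0 * (1 + J * Real.exp J)) =
      (2 * ν / 3)⁻¹ * (F 0 * (1 + J * Real.exp J)) by field_simp]
    rw [le_inv_mul_iff₀ (by positivity : (0 : ℝ) < 2 * ν / 3)]
    exact h2
  -- the Serrin majorant `N₉(t) = (∫ (|u|²+1)^{9/2})^{1/9}`
  set N₉ : ℝ → ℝ := fun s => (∫ x, (‖u s x‖ ^ 2 + 1) ^ (9 / 2 : ℝ)) ^ (1 / 9 : ℝ) with hN₉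
  have hQ9 : Torus.IsSmoothSpaceTimeOn (Ico 0 T) (fun s x => (‖u s x‖ ^ 2 + 1) ^ (9 / 2 : ℝ)) :=
    smooth_normSqAddOne_rpow h.smooth_velocity _
  have hI90 : ∀ s, 0 ≤ ∫ x, (‖u s x‖ ^ 2 + 1) ^ (9 / 2 : ℝ) := fun s =>
    integral_nonneg fun x => Real.rpow_nonneg (by positivity) _
  have hN₉c : ContinuousOn N₉ (Ico 0 T) :=
    (hQ9.continuousOn_integral (convex_Ico 0 T)).rpow_const fun s _ => Or.inr (by norm_num)
  have hN₉0 : ∀ s ∈ Ico 0 T, 0 ≤ N₉ s := fun s _ => Real.rpow_nonneg (hI90 s) _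
  have hN₉u : ∀ s ∈ Ico 0 T, (∫ x, ‖u s x‖ ^ (9 : ℝ)) ^ (1 / (9 : ℝ)) ≤ N₉ s := by
    intro s hs
    have hus : Torus.IsSmooth (u s) := h.smooth_velocity.isSmooth_slice hs
    refine Real.rpow_le_rpow (integral_nonneg fun x => Real.rpow_nonneg (norm_nonneg _) _) ?_
      (by norm_num)
    refine integral_mono_of_nonneg (ae_of_all _ fun x => Real.rpow_nonneg (norm_nonneg _) _)
      ((hQ9.isSmooth_slice hs).continuous.integrable_unitAddTorus) (ae_of_all _ fun x => ?_)
    show ‖u s x‖ ^ (9 : ℝ) ≤ (‖u s x‖ ^ 2 + 1) ^ (9 / 2 : ℝ)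
    calc ‖u s x‖ ^ (9 : ℝ) = (‖u s x‖ ^ 2) ^ (9 / 2 : ℝ) := by
          rw [← Real.rpow_natCast, ← Real.rpow_mul (norm_nonneg _)]; norm_num
      _ ≤ (‖u s x‖ ^ 2 + 1) ^ (9 / 2 : ℝ) :=
          Real.rpow_le_rpow (sq_nonneg _) (by linarith) (by norm_num)
  -- `N₉³ ≤ K^{1/3} (F + G)` (the embedding `H¹ ⊂ L⁶` for `(|u|²+1)^{3/4}`)
  have hN₉3 : ∀ s ∈ Ico 0 T, N₉ s ^ (2 * (9 : ℝ) / (9 - 3)) ≤ K ^ (1 / 3 : ℝ) * (F s + G s) := by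
    intro s hs
    have hus : Torus.IsSmooth (u s) := h.smooth_velocity.isSmooth_slice hs
    have hQpos : ∀ x, 0 < ‖u s x‖ ^ 2 + 1 := fun x => by positivity
    have hQs : Torus.IsSmooth (fun y => ‖u s y‖ ^ 2 + 1) := hus.norm_sq.add (Torus.isSmooth_const _)
    have hfs : Torus.IsSmooth (fun x => (‖u s x‖ ^ 2 + 1) ^ (3 / 4 : ℝ)) :=
      ContDiff.rpow_const_of_ne hQs fun v => (hQpos _).ne'
    have h6 := hK _ hfs
    have ef2 : ∀ x, ((‖u s x‖ ^ 2 + 1) ^ (3 / 4 : ℝ)) ^ 2 = (‖u s x‖ ^ 2 + 1) ^ (3 / 2 : ℝ) :=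
      fun x => by rw [← Real.rpow_natCast, ← Real.rpow_mul (hQpos x).le]; norm_num
    have ef6 : ∀ x, ((‖u s x‖ ^ 2 + 1) ^ (3 / 4 : ℝ)) ^ 6 = (‖u s x‖ ^ 2 + 1) ^ (9 / 2 : ℝ) :=
      fun x => by rw [← Real.rpow_natCast, ← Real.rpow_mul (hQpos x).le]; norm_num
    simp only [ef2, ef6] at h6
    have hFG : 0 ≤ F s + G s := add_nonneg (hFnn s) (hGnn s)
    have e9 : N₉ s ^ (2 * (9 : ℝ) / (9 - 3)) = (∫ x, (‖u s x‖ ^ 2 + 1) ^ (9 / 2 : ℝ)) ^ (1 / 3 : ℝ) := by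
      rw [hN₉, ← Real.rpow_mul (hI90 s)]
      norm_num
    rw [e9]
    calc (∫ x, (‖u s x‖ ^ 2 + 1) ^ (9 / 2 : ℝ)) ^ (1 / 3 : ℝ)
        ≤ (K * (F s + G s) ^ 3) ^ (1 / 3 : ℝ) := Real.rpow_le_rpow (hI90 s) h6 (by norm_num)
      _ = K ^ (1 / 3 : ℝ) * (F s + G s) := by
          rw [Real.mul_rpow hK0 (pow_nonneg hFG 3), ← Real.rpow_natCast, ← Real.rpow_mul hFG]
          norm_num
  -- `∫₀ᵗ N₉³ ≤ I₉`
  set I₉ : ℝ := K ^ (1 / 3 : ℝ) * (T * B + Gb) with hI₉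
  have hK3 : 0 ≤ K ^ (1 / 3 : ℝ) := Real.rpow_nonneg hK0 _
  have hI9 : ∀ t ∈ Ico 0 T, ∫ τ in (0 : ℝ)..t, N₉ τ ^ (2 * (9 : ℝ) / (9 - 3)) ≤ I₉ := by
    intro t ht
    rcases ht.1.eq_or_lt with h0 | h0t
    · rw [← h0, intervalIntegral.integral_same, hI₉]
      have hGb0 : 0 ≤ Gb := by rw [hGbdef]; positivity
      positivity
    obtain ⟨hFB, hGint, hGc⟩ := hwin t ht h0t
    have hsub : Icc 0 t ⊆ Ico 0 T := fun s hs => ⟨hs.1, hs.2.trans_lt ht.2⟩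
    have hFc : ContinuousOn F (Icc 0 t) :=
      ((smooth_normSqAddOne_rpow h.smooth_velocity (3 / 2 : ℝ)).continuousOn_integral
        (convex_Ico 0 T)).mono hsub
    have hN9i : IntervalIntegrable (fun τ => N₉ τ ^ (2 * (9 : ℝ) / (9 - 3))) volume 0 t :=
      (((hN₉c.mono hsub).rpow_const fun s hs => Or.inr (by norm_num))).intervalIntegrable_of_Icc
        h0t.le
    have hFGi : IntervalIntegrable (fun τ => K ^ (1 / 3 : ℝ) * (F τ + G τ)) volume 0 t :=
      (continuousOn_const.mul (hFc.add hGc)).intervalIntegrable_of_Icc h0t.le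
    calc ∫ τ in (0 : ℝ)..t, N₉ τ ^ (2 * (9 : ℝ) / (9 - 3))
        ≤ ∫ τ in (0 : ℝ)..t, K ^ (1 / 3 : ℝ) * (F τ + G τ) :=
          intervalIntegral.integral_mono_on h0t.le hN9i hFGi fun τ hτ => hN₉3 τ (hsub hτ)
      _ = K ^ (1 / 3 : ℝ) * ((∫ τ in (0 : ℝ)..t, F τ) + ∫ τ in (0 : ℝ)..t, G τ) := by
          rw [intervalIntegral.integral_const_mul, intervalIntegral.integral_add
            (hFc.intervalIntegrable_of_Icc h0t.le) (hGc.intervalIntegrable_of_Icc h0t.le)]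
      _ ≤ K ^ (1 / 3 : ℝ) * (T * B + Gb) := by
          refine mul_le_mul_of_nonneg_left (add_le_add ?_ hGint) hK3
          calc ∫ τ in (0 : ℝ)..t, F τ ≤ ∫ τ in (0 : ℝ)..t, B :=
                intervalIntegral.integral_mono_on h0t.le (hFc.intervalIntegrable_of_Icc h0t.le)
                  intervalIntegrable_const fun τ hτ => hFB τ hτ
            _ = t * B := by rw [intervalIntegral.integral_const, smul_eq_mul, sub_zero]
            _ ≤ T * B := mul_le_mul_of_nonneg_right ht.2.le hB0
  exact Torus.classicalNS_continuation_of_Ls_rpow_integral_le hd hν hT (by norm_num : (3 : ℝ) < 9)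
    h hmean hN₉c hN₉0 hN₉u hI9

/-! ### §6 Theorem 1: `div(u/|u|) ∈ L^p(0,T; L^q)`, `2/p + 3/q ≤ 1/2`, `q ≥ 6` -/

omit [DecidableEq d] in
/-- `L^r` norm of a product by Hölder: `‖fg‖_r ≤ ‖f‖_α ‖g‖_β` for `1/r = 1/α + 1/β` and
continuous `f, g ≥ 0` on `T^d`. [folklore] -/
private theorem lr_norm_mul_le {α β r : ℝ} (hα : 0 < α) (hβ : 0 < β) (hr0 : 0 < r)
    (hr : 1 / r = 1 / α + 1 / β) {f g : UnitAddTorus d → ℝ} (hf : Continuous f)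
    (hg : Continuous g) (hf0 : ∀ x, 0 ≤ f x) (hg0 : ∀ x, 0 ≤ g x) :
    (∫ x, (f x * g x) ^ r) ^ (1 / r) ≤ (∫ x, f x ^ α) ^ (1 / α) * (∫ x, g x ^ β) ^ (1 / β) := by
  have ha : 0 < r / α := by positivity
  have hb : 0 < r / β := by positivity
  have hab : r / α + r / β = 1 := by
    have h1 : r / α + r / β = r * (1 / α + 1 / β) := by ring
    rw [h1, ← hr]
    field_simp
  have hH := Vasseur2009.integral_mul_le_rpow_mul_rpow (f := fun x => f x ^ r) (g := fun x => g x ^ r)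
    (hf.rpow_const fun x => Or.inr hr0.le) (hg.rpow_const fun x => Or.inr hr0.le)
    (fun x => Real.rpow_nonneg (hf0 x) _) (fun x => Real.rpow_nonneg (hg0 x) _) ha hb hab
  have ea : ∀ x, (f x ^ r) ^ (r / α)⁻¹ = f x ^ α := fun x => by
    rw [← Real.rpow_mul (hf0 x), inv_div, mul_div_cancel₀ _ hr0.ne']
  have eb : ∀ x, (g x ^ r) ^ (r / β)⁻¹ = g x ^ β := fun x => by
    rw [← Real.rpow_mul (hg0 x), inv_div, mul_div_cancel₀ _ hr0.ne']
  simp only [ea, eb] at hH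
  have efg : ∀ x, (f x * g x) ^ r = f x ^ r * g x ^ r := fun x => Real.mul_rpow (hf0 x) (hg0 x)
  have hI0 : 0 ≤ ∫ x, (f x * g x) ^ r :=
    integral_nonneg fun x => Real.rpow_nonneg (mul_nonneg (hf0 x) (hg0 x)) _
  have hA0 : 0 ≤ ∫ x, f x ^ α := integral_nonneg fun x => Real.rpow_nonneg (hf0 x) _
  have hB0 : 0 ≤ ∫ x, g x ^ β := integral_nonneg fun x => Real.rpow_nonneg (hg0 x) _
  calc (∫ x, (f x * g x) ^ r) ^ (1 / r)
      ≤ ((∫ x, f x ^ α) ^ (r / α) * (∫ x, g x ^ β) ^ (r / β)) ^ (1 / r) := by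
        refine Real.rpow_le_rpow hI0 ?_ (by positivity)
        rw [integral_congr_ae (ae_of_all _ efg)]
        exact hH
    _ = (∫ x, f x ^ α) ^ (1 / α) * (∫ x, g x ^ β) ^ (1 / β) := by
        rw [Real.mul_rpow (Real.rpow_nonneg hA0 _) (Real.rpow_nonneg hB0 _),
          ← Real.rpow_mul hA0, ← Real.rpow_mul hB0]
        congr 2
        · field_simp
        · field_simp

/-- `(s, x) ↦ |u(s, x)|⁶` and `(s, x) ↦ ∑ₖ |∂ₖu(s, x)|²` are jointly smooth along a classical
solution. [folklore] -/
private theorem smooth_normSix_gradSq {a b : ℝ} {u : ℝ → UnitAddTorus d → EuclideanSpace ℝ d}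
    (hu : Torus.IsSmoothSpaceTimeOn (Icc a b) u) (hab : a < b) :
    Torus.IsSmoothSpaceTimeOn (Icc a b) (fun s x => ‖u s x‖ ^ 6) ∧
      Torus.IsSmoothSpaceTimeOn (Icc a b) (fun s x => ∑ k, ‖Torus.partialDeriv k (u s) x‖ ^ 2) := by
  have hU : UniqueDiffOn ℝ (Icc a b) := uniqueDiffOn_Icc hab
  have hQ : Torus.IsSmoothSpaceTimeOn (Icc a b) (fun s x => ⟪u s x, u s x⟫) := hu.inner hu
  refine ⟨?_, ?_⟩
  · have h6 := (hQ.mul hQ).mul hQ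
    have e : (fun s x => ‖u s x‖ ^ 6) = fun s x => ⟪u s x, u s x⟫ * ⟪u s x, u s x⟫ * ⟪u s x, u s x⟫ := by
      funext s x
      rw [real_inner_self_eq_norm_sq]; ring
    rw [e]; exact h6
  · have h : ∀ k, Torus.IsSmoothSpaceTimeOn (Icc a b)
        (fun s x => ‖Torus.partialDeriv k (u s) x‖ ^ 2) := by
      intro k
      have h1 := (hu.partialDeriv hU k).inner (hu.partialDeriv hU k)
      have e : (fun s x => ‖Torus.partialDeriv k (u s) x‖ ^ 2) =
          fun s x => ⟪Torus.partialDeriv k (u s) x, Torus.partialDeriv k (u s) x⟫ := by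
        funext s x
        rw [real_inner_self_eq_norm_sq]
      rw [e]; exact h1
    exact Torus.IsSmoothSpaceTimeOn.sum (s := Finset.univ) fun k (_ : k ∈ Finset.univ) => h k

/-- **The energy-class input `u ∈ L²(0,T; L⁶)`** ("Since `u` lies in `L²(0,∞; L⁶(ℝ³))` …
`u ∈ L^a(L^b)` for `2/a + 3/b = 3/2`", the case `(a, b) = (2, 6)`): along a classical mean-zero
solution of the unforced equations on `[0, T) × T^d`, `card d = 3`, `t ↦ ∫|u(t)|⁶` is continuous
and `∫₀ᵗ (∫|u|⁶)^{1/3} ≤ C_S^{1/3} ‖u(0)‖₂²/(2ν)` on `[0, T)` (the tree's mean-zero Sobolev bound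
`Torus.exists_integral_norm_pow_six_le_gradNormSq_cube` and energy-class bound
`Torus.classicalNS_integral_gradNormSq_le`). [cite: Vasseur2009, proof of Thm 1 (p. 2, `u ∈ L^a(L^b)`)] -/
private theorem exists_integral_L6_sq_le (hd : Fintype.card d = 3) (hν : 0 < ν)
    (h : Torus.IsClassicalNSSolutionOn (Ico 0 T) ν 0 u p)
    (hmean : ∀ t ∈ Ico 0 T, Torus.HasZeroMean (u t)) :
    ∃ CE : ℝ, 0 ≤ CE ∧ ContinuousOn (fun s => ∫ x, ‖u s x‖ ^ 6) (Ico 0 T) ∧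
      ∀ t ∈ Ico 0 T, ∫ τ in (0 : ℝ)..t, (∫ x, ‖u τ x‖ ^ 6) ^ (1 / 3 : ℝ) ≤ CE := by
  obtain ⟨CS, hCS0, hCS⟩ := Torus.exists_integral_norm_pow_six_le_gradNormSq_cube (d := d) hd
  set CE : ℝ := CS ^ (1 / 3 : ℝ) * ((∫ x, ‖u 0 x‖ ^ 2) / (2 * ν)) with hCE
  have hE0 : 0 ≤ ∫ x, ‖u 0 x‖ ^ 2 := integral_nonneg fun x => sq_nonneg _
  have hCE0 : 0 ≤ CE := by rw [hCE]; positivity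
  -- continuity of `s ↦ ∫|u(s)|⁶` on `[0, T)`
  have hQ : Torus.IsSmoothSpaceTimeOn (Ico 0 T) (fun s x => ⟪u s x, u s x⟫) :=
    h.smooth_velocity.inner h.smooth_velocity
  have h6s : Torus.IsSmoothSpaceTimeOn (Ico 0 T) (fun s x => ‖u s x‖ ^ 6) := by
    have h6 := (hQ.mul hQ).mul hQ
    have e : (fun s x => ‖u s x‖ ^ 6) = fun s x => ⟪u s x, u s x⟫ * ⟪u s x, u s x⟫ * ⟪u s x, u s x⟫ := by
      funext s x
      rw [real_inner_self_eq_norm_sq]; ring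
    rw [e]; exact h6
  have h6c : ContinuousOn (fun s => ∫ x, ‖u s x‖ ^ 6) (Ico 0 T) :=
    h6s.continuousOn_integral (convex_Ico 0 T)
  refine ⟨CE, hCE0, h6c, fun t ht => ?_⟩
  rcases ht.1.eq_or_lt with h0 | h0t
  · rw [← h0, intervalIntegral.integral_same]; exact hCE0
  have hsub : Icc 0 t ⊆ Ico 0 T := fun s hs => ⟨hs.1, hs.2.trans_lt ht.2⟩
  have h' : Torus.IsClassicalNSSolutionOn (Icc 0 t) ν 0 u p := h.mono hsub (uniqueDiffOn_Icc h0t)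
  have hGc : ContinuousOn (fun s => Torus.gradNormSq (u s)) (Icc 0 t) :=
    (smooth_normSix_gradSq h'.smooth_velocity h0t).2.continuousOn_integral (convex_Icc 0 t)
  have hpt : ∀ s ∈ Icc 0 t, (∫ x, ‖u s x‖ ^ 6) ^ (1 / 3 : ℝ) ≤
      CS ^ (1 / 3 : ℝ) * Torus.gradNormSq (u s) := by
    intro s hs
    have hus : Torus.IsSmooth (u s) := h.smooth_velocity.isSmooth_slice (hsub hs)
    have h1 := hCS (u s) hus (hmean s (hsub hs))
    have hG0 : 0 ≤ Torus.gradNormSq (u s) := Torus.gradNormSq_nonneg _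
    calc (∫ x, ‖u s x‖ ^ 6) ^ (1 / 3 : ℝ)
        ≤ (CS * Torus.gradNormSq (u s) ^ 3) ^ (1 / 3 : ℝ) :=
          Real.rpow_le_rpow (integral_nonneg fun x => pow_nonneg (norm_nonneg _) 6) h1
            (by norm_num)
      _ = CS ^ (1 / 3 : ℝ) * Torus.gradNormSq (u s) := by
          rw [Real.mul_rpow hCS0 (pow_nonneg hG0 3), ← Real.rpow_natCast, ← Real.rpow_mul hG0]
          norm_num
  have hi1 : IntervalIntegrable (fun s => (∫ x, ‖u s x‖ ^ 6) ^ (1 / 3 : ℝ)) volume 0 t :=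
    ((h6c.mono hsub).rpow_const fun s _ => Or.inr (by norm_num)).intervalIntegrable_of_Icc h0t.le
  have hi2 : IntervalIntegrable (fun s => CS ^ (1 / 3 : ℝ) * Torus.gradNormSq (u s)) volume 0 t :=
    (continuousOn_const.mul hGc).intervalIntegrable_of_Icc h0t.le
  calc ∫ τ in (0 : ℝ)..t, (∫ x, ‖u τ x‖ ^ 6) ^ (1 / 3 : ℝ)
      ≤ ∫ τ in (0 : ℝ)..t, CS ^ (1 / 3 : ℝ) * Torus.gradNormSq (u τ) :=
        intervalIntegral.integral_mono_on h0t.le hi1 hi2 hpt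
    _ = CS ^ (1 / 3 : ℝ) * ∫ τ in (0 : ℝ)..t, Torus.gradNormSq (u τ) :=
        intervalIntegral.integral_const_mul _ _
    _ ≤ CS ^ (1 / 3 : ℝ) * ((∫ x, ‖u 0 x‖ ^ 2) / (2 * ν)) :=
        mul_le_mul_of_nonneg_left (Torus.classicalNS_integral_gradNormSq_le hν h0t h')
          (Real.rpow_nonneg hCS0 _)

/-- **Vasseur's Theorem 1 on `T³` (continuation form): `div(u/|u|) ∈ L^γ(0,T; L^q)`,
`2/γ + 3/q ≤ 1/2`, `q > 6`, prevents blow-up.** Printed: "Let `u` be a Leray–Hopf solution …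
If `div(u/|u|) ∈ L^p(0,∞; L^q(ℝ³))` with `2/p + 3/q ≤ 1/2`, `q ≥ 6`, `p ≥ 4`, then `u` is smooth on
`(0,∞) × ℝ³`." Here: a classical solution of the unforced Navier–Stokes equations (`ν > 0`) on
`[0, T) × T^d`, `card d = 3`, `T > 0`, with mean-zero velocity slices; a family `E(t) ≥ 0` of
continuous functions dominating `div(u/|u|)` quotient-free: `|⟪u(t), (u(t)·∇)u(t)⟫| ≤ |u(t)|³ E(t)`
pointwise (`= |div(u/|u|)|` off the zero set, by the identity (3)); `6 < q < ∞`, `γ > 0` with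
`2/γ + 3/q ≤ 1/2` (so `γ ≥ 4q/(q − 6) > 4`); a continuous majorant `N(t) ≥ (∫E(t)^q)^{1/q}` on
`[0, T)` with `∫₀ᵗ N^γ ≤ I`: then the solution continues past `T`. Proof as printed: `|u| E` is a
dominating family for `|u| div(u/|u|)` with `‖|u|E‖_{L^{q̄}} ≤ ‖u‖_{L⁶}‖E‖_{L^q}`, `1/q̄ = 1/q + 1/6`
(`(a, b) = (2, 6)`), and `∫₀ᵗ (‖u‖_{L⁶}N)^{4q/(3q−6)} ≤ ∫₀ᵗ ‖u‖²_{L⁶} + T + I` (Young; the energy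
class `exists_integral_L6_sq_le`); then `Torus.classicalNS_continuation_of_selfStrain_Lq_rpow_integral_le`
with `(q̄, 4q/(3q−6))`, `2/(4q/(3q−6)) + 3/q̄ = 2`. The endpoint `q = 6` (`p = ∞`) is
`Torus.classicalNS_continuation_of_divergence_dir_L6_le`. [cite: Vasseur2009, Thm 1 (p. 2)] -/
theorem Torus.classicalNS_continuation_of_divergence_dir_Lq_rpow_integral_le
    (hd : Fintype.card d = 3) {q γ : ℝ} (hν : 0 < ν) (hT : 0 < T) (hq : 6 < q) (hγ : 0 < γ)
    (hγq : 2 / γ + 3 / q ≤ 1 / 2) (h : Torus.IsClassicalNSSolutionOn (Ico 0 T) ν 0 u p)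
    (hmean : ∀ t ∈ Ico 0 T, Torus.HasZeroMean (u t)) {E : ℝ → UnitAddTorus d → ℝ}
    (hEc : ∀ t ∈ Ico 0 T, Continuous (E t)) (hE0 : ∀ t ∈ Ico 0 T, ∀ x, 0 ≤ E t x)
    (hdom : ∀ t ∈ Ico 0 T, ∀ x, |⟪u t x, Torus.convect (u t) (u t) x⟫| ≤ ‖u t x‖ ^ 3 * E t x)
    {N : ℝ → ℝ} (hNc : ContinuousOn N (Ico 0 T))
    (hN : ∀ t ∈ Ico 0 T, (∫ x, E t x ^ q) ^ (1 / q) ≤ N t)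
    {I : ℝ} (hI : ∀ t ∈ Ico 0 T, ∫ τ in (0 : ℝ)..t, N τ ^ γ ≤ I) :
    ∃ T' : ℝ, T < T' ∧ ∃ (u' : ℝ → UnitAddTorus d → EuclideanSpace ℝ d)
      (p' : ℝ → UnitAddTorus d → ℝ), Torus.IsClassicalNSSolutionOn (Icc 0 T') ν 0 u' p' ∧
        (∀ t ∈ Icc 0 T', Torus.HasZeroMean (u' t)) ∧ ∀ t ∈ Ico 0 T, u' t = u t := by
  have hq0 : 0 < q := by linarith
  have hq6 : 0 < q - 6 := by linarith
  have h3q6 : 0 < 3 * q - 6 := by linarith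
  -- exponents
  set qb : ℝ := 6 * q / (q + 6) with hqb
  set γb : ℝ := 4 * q / (3 * q - 6) with hγb
  set p₁ : ℝ := 4 * q / (q - 6) with hp₁
  have hqb32 : 3 / 2 < qb := by
    rw [hqb, lt_div_iff₀ (by positivity)]; nlinarith
  have hqb0 : 0 < qb := by linarith
  have hγb0 : 0 < γb := by rw [hγb]; positivity
  have hp₁0 : 0 < p₁ := by rw [hp₁]; positivity
  have hqne : q ≠ 0 := hq0.ne'
  have h3q6ne : 3 * q - 6 ≠ 0 := h3q6.ne'
  have hq6ne : q + 6 ≠ 0 := by positivity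
  have hq6ne' : q - 6 ≠ 0 := hq6.ne'
  have hγbqb : 2 / γb + 3 / qb ≤ 2 := by
    have e1 : 2 / γb = (3 * q - 6) / (2 * q) := by
      rw [hγb, div_div_eq_mul_div, div_eq_div_iff (by positivity) (by positivity)]
      ring
    have e2 : 3 / qb = (q + 6) / (2 * q) := by
      rw [hqb, div_div_eq_mul_div, div_eq_div_iff (by positivity) (by positivity)]
      ring
    rw [e1, e2, ← add_div, div_le_iff₀ (by positivity)]
    linarith
  have hp₁γ : p₁ ≤ γ := by
    -- `2/γ ≤ 1/2 − 3/q = (q − 6)/(2q)` ⇒ `γ ≥ 4q/(q−6)`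
    have h1 : 2 / γ ≤ (q - 6) / (2 * q) := by
      have : (q - 6) / (2 * q) = 1 / 2 - 3 / q := by
        rw [eq_sub_iff_add_eq, div_add_div _ _ (by positivity) hqne,
          div_eq_div_iff (by positivity) (by norm_num)]
        ring
      rw [this]; linarith
    rw [div_le_div_iff₀ hγ (by positivity)] at h1
    rw [hp₁, div_le_iff₀ hq6]
    linarith
  have hw₁ : 0 ≤ 2 * q / (3 * q - 6) := by positivity
  have hw₂ : 0 ≤ (q - 6) / (3 * q - 6) := by positivity
  have hw : 2 * q / (3 * q - 6) + (q - 6) / (3 * q - 6) = 1 := by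
    rw [← add_div, div_eq_one_iff_eq h3q6ne]
    ring
  have hw₁1 : 2 * q / (3 * q - 6) ≤ 1 := by linarith
  have hw₂1 : (q - 6) / (3 * q - 6) ≤ 1 := by linarith
  have hqrel : 1 / qb = 1 / 6 + 1 / q := by
    rw [hqb, one_div_div, div_add_div _ _ (by norm_num) hqne, div_eq_div_iff (by positivity)
      (by positivity)]
    ring
  -- the energy-class input
  obtain ⟨CE, hCE0, h6c, hCE⟩ := exists_integral_L6_sq_le (d := d) hd hν h hmean
  have hI60 : ∀ s, 0 ≤ ∫ x, ‖u s x‖ ^ 6 := fun s => integral_nonneg fun x => pow_nonneg (norm_nonneg _) 6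
  set A : ℝ → ℝ := fun s => (∫ x, ‖u s x‖ ^ 6) ^ (1 / 6 : ℝ) with hA
  have hAc : ContinuousOn A (Ico 0 T) := h6c.rpow_const fun s _ => Or.inr (by norm_num)
  have hA0 : ∀ s, 0 ≤ A s := fun s => Real.rpow_nonneg (hI60 s) _
  have hN0 : ∀ t ∈ Ico 0 T, 0 ≤ N t := fun t ht =>
    le_trans (Real.rpow_nonneg (integral_nonneg fun x => Real.rpow_nonneg (hE0 t ht x) _) _) (hN t ht)
  have hI0 : 0 ≤ I := by
    have h0 := hI 0 ⟨le_rfl, hT⟩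
    rwa [intervalIntegral.integral_same] at h0
  -- the dominating family `D = |u| E` and its majorant `A N`
  refine Torus.classicalNS_continuation_of_selfStrain_Lq_rpow_integral_le hd hν hT hqb32 hγb0
    hγbqb h hmean (D := fun t x => ‖u t x‖ * E t x) (N := fun t => A t * N t)
    (I := CE + T + I) (fun t ht => ?_) (fun t ht x => ?_) (fun t ht x => ?_) (hAc.mul hNc)
    (fun t ht => ?_) (fun t ht => ?_)
  · exact (h.smooth_velocity.isSmooth_slice ht).continuous.norm.mul (hEc t ht)
  · exact mul_nonneg (norm_nonneg _) (hE0 t ht x)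
  · calc |⟪u t x, Torus.convect (u t) (u t) x⟫| ≤ ‖u t x‖ ^ 3 * E t x := hdom t ht x
      _ = ‖u t x‖ ^ 2 * (‖u t x‖ * E t x) := by ring
  · -- `‖|u| E‖_{q̄} ≤ ‖u‖₆ ‖E‖_q ≤ A N`
    have hus : Torus.IsSmooth (u t) := h.smooth_velocity.isSmooth_slice ht
    have h1 := lr_norm_mul_le (by norm_num : (0 : ℝ) < 6) hq0 hqb0 hqrel hus.continuous.norm
      (hEc t ht) (fun x => norm_nonneg _) (hE0 t ht)
    have e6 : ∫ x, ‖u t x‖ ^ (6 : ℝ) = ∫ x, ‖u t x‖ ^ 6 :=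
      integral_congr_ae (ae_of_all _ fun x => by
        show ‖u t x‖ ^ (6 : ℝ) = ‖u t x‖ ^ 6
        rw [show (6 : ℝ) = ((6 : ℕ) : ℝ) by norm_num, Real.rpow_natCast])
    rw [e6] at h1
    exact h1.trans (mul_le_mul_of_nonneg_left (hN t ht) (hA0 t))
  · -- `∫₀ᵗ (A N)^{γ̄} ≤ CE + T + I`
    rcases ht.1.eq_or_lt with h0 | h0t
    · rw [← h0, intervalIntegral.integral_same]; positivity
    have hsub : Icc 0 t ⊆ Ico 0 T := fun s hs => ⟨hs.1, hs.2.trans_lt ht.2⟩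
    -- pointwise Young: `(A N)^{γ̄} ≤ A² + 1 + N^γ`
    have hpt : ∀ s ∈ Icc 0 t, (A s * N s) ^ γb ≤ (∫ x, ‖u s x‖ ^ 6) ^ (1 / 3 : ℝ) + (1 + N s ^ γ) := by
      intro s hs
      have hNs := hN0 s (hsub hs)
      have hAM := Real.geom_mean_le_arith_mean2_weighted hw₁ hw₂ (sq_nonneg (A s))
        (Real.rpow_nonneg hNs p₁) hw
      have e1 : (A s ^ 2) ^ (2 * q / (3 * q - 6)) = A s ^ γb := by
        rw [← Real.rpow_natCast, ← Real.rpow_mul (hA0 s), hγb]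
        congr 1; push_cast; ring
      have e2 : (N s ^ p₁) ^ ((q - 6) / (3 * q - 6)) = N s ^ γb := by
        rw [← Real.rpow_mul hNs, hp₁, hγb]
        congr 1
        rw [div_mul_div_comm, div_eq_div_iff (mul_ne_zero hq6ne' h3q6ne) h3q6ne]
        ring
      have eA2 : A s ^ 2 = (∫ x, ‖u s x‖ ^ 6) ^ (1 / 3 : ℝ) := by
        rw [hA, ← Real.rpow_natCast, ← Real.rpow_mul (hI60 s)]
        norm_num
      rw [e1, e2] at hAM
      have hNp : N s ^ p₁ ≤ 1 + N s ^ γ := by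
        rcases le_or_gt (N s) 1 with h1 | h1
        · have := Real.rpow_le_one hNs h1 hp₁0.le
          linarith [Real.rpow_nonneg hNs γ]
        · have := Real.rpow_le_rpow_of_exponent_le h1.le hp₁γ
          linarith
      calc (A s * N s) ^ γb = A s ^ γb * N s ^ γb := Real.mul_rpow (hA0 s) hNs
        _ ≤ 2 * q / (3 * q - 6) * A s ^ 2 + (q - 6) / (3 * q - 6) * N s ^ p₁ := hAM
        _ ≤ A s ^ 2 + N s ^ p₁ := by
            nlinarith [sq_nonneg (A s), Real.rpow_nonneg hNs p₁]
        _ ≤ (∫ x, ‖u s x‖ ^ 6) ^ (1 / 3 : ℝ) + (1 + N s ^ γ) := by rw [← eA2]; linarith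
    have hNγc : ContinuousOn (fun s => N s ^ γ) (Icc 0 t) :=
      (hNc.mono hsub).rpow_const fun s hs => Or.inr hγ.le
    have hi1 : IntervalIntegrable (fun s => (A s * N s) ^ γb) volume 0 t :=
      (((hAc.mul hNc).mono hsub).rpow_const fun s hs => Or.inr hγb0.le).intervalIntegrable_of_Icc
        h0t.le
    have hi6 : IntervalIntegrable (fun s => (∫ x, ‖u s x‖ ^ 6) ^ (1 / 3 : ℝ)) volume 0 t :=
      ((h6c.mono hsub).rpow_const fun s _ => Or.inr (by norm_num)).intervalIntegrable_of_Icc h0t.le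
    have hi2 : IntervalIntegrable (fun s => (∫ x, ‖u s x‖ ^ 6) ^ (1 / 3 : ℝ) + (1 + N s ^ γ))
        volume 0 t := hi6.add (intervalIntegrable_const.add (hNγc.intervalIntegrable_of_Icc h0t.le))
    calc ∫ τ in (0 : ℝ)..t, (A τ * N τ) ^ γb
        ≤ ∫ τ in (0 : ℝ)..t, ((∫ x, ‖u τ x‖ ^ 6) ^ (1 / 3 : ℝ) + (1 + N τ ^ γ)) :=
          intervalIntegral.integral_mono_on h0t.le hi1 hi2 hpt
      _ = (∫ τ in (0 : ℝ)..t, (∫ x, ‖u τ x‖ ^ 6) ^ (1 / 3 : ℝ)) +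
          (t + ∫ τ in (0 : ℝ)..t, N τ ^ γ) := by
          rw [intervalIntegral.integral_add hi6
              (intervalIntegrable_const.add (hNγc.intervalIntegrable_of_Icc h0t.le)),
            intervalIntegral.integral_add intervalIntegrable_const
              (hNγc.intervalIntegrable_of_Icc h0t.le),
            intervalIntegral.integral_const, smul_eq_mul, sub_zero, mul_one]
      _ ≤ CE + T + I := by
          have := hCE t ht
          have := hI t ht
          linarith [ht.2.le]

/-- **Vasseur's Theorem 1 on `T³`, endpoint `q = 6`, `p = ∞` (continuation form):
`div(u/|u|) ∈ L^∞(0,T; L⁶)` prevents blow-up.** As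
`Torus.classicalNS_continuation_of_divergence_dir_Lq_rpow_integral_le`, with a uniform bound
`(∫E(t)⁶)^{1/6} ≤ L` on `[0, T)` in place of the `L^γ_t` majorant: `|u| E` is a dominating family
for `|u| div(u/|u|)` with `‖|u|E‖_{L³} ≤ ‖u‖_{L⁶} L` and `∫₀ᵗ ‖u‖²_{L⁶} L² ≤ C L²` (energy class),
`(q̄, γ̄) = (3, 2)`, `2/2 + 3/3 = 2`. [cite: Vasseur2009, Thm 1 (p. 2, the case `q = 6`)] -/
theorem Torus.classicalNS_continuation_of_divergence_dir_L6_le (hd : Fintype.card d = 3)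
    (hν : 0 < ν) (hT : 0 < T) (h : Torus.IsClassicalNSSolutionOn (Ico 0 T) ν 0 u p)
    (hmean : ∀ t ∈ Ico 0 T, Torus.HasZeroMean (u t)) {E : ℝ → UnitAddTorus d → ℝ}
    (hEc : ∀ t ∈ Ico 0 T, Continuous (E t)) (hE0 : ∀ t ∈ Ico 0 T, ∀ x, 0 ≤ E t x)
    (hdom : ∀ t ∈ Ico 0 T, ∀ x, |⟪u t x, Torus.convect (u t) (u t) x⟫| ≤ ‖u t x‖ ^ 3 * E t x)
    {L : ℝ} (hL : ∀ t ∈ Ico 0 T, (∫ x, E t x ^ (6 : ℝ)) ^ (1 / (6 : ℝ)) ≤ L) :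
    ∃ T' : ℝ, T < T' ∧ ∃ (u' : ℝ → UnitAddTorus d → EuclideanSpace ℝ d)
      (p' : ℝ → UnitAddTorus d → ℝ), Torus.IsClassicalNSSolutionOn (Icc 0 T') ν 0 u' p' ∧
        (∀ t ∈ Icc 0 T', Torus.HasZeroMean (u' t)) ∧ ∀ t ∈ Ico 0 T, u' t = u t := by
  obtain ⟨CE, hCE0, h6c, hCE⟩ := exists_integral_L6_sq_le (d := d) hd hν h hmean
  have hI60 : ∀ s, 0 ≤ ∫ x, ‖u s x‖ ^ 6 := fun s => integral_nonneg fun x => pow_nonneg (norm_nonneg _) 6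
  set A : ℝ → ℝ := fun s => (∫ x, ‖u s x‖ ^ 6) ^ (1 / 6 : ℝ) with hA
  have hAc : ContinuousOn A (Ico 0 T) := h6c.rpow_const fun s _ => Or.inr (by norm_num)
  have hA0 : ∀ s, 0 ≤ A s := fun s => Real.rpow_nonneg (hI60 s) _
  have hL0 : 0 ≤ L := le_trans (Real.rpow_nonneg (integral_nonneg fun x =>
    Real.rpow_nonneg (hE0 0 ⟨le_rfl, hT⟩ x) _) _) (hL 0 ⟨le_rfl, hT⟩)
  refine Torus.classicalNS_continuation_of_selfStrain_Lq_rpow_integral_le hd hν hT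
    (by norm_num : (3 : ℝ) / 2 < 3) (by norm_num : (0 : ℝ) < 2) (by norm_num) h hmean
    (D := fun t x => ‖u t x‖ * E t x) (N := fun t => A t * L) (I := L ^ 2 * CE)
    (fun t ht => ?_) (fun t ht x => ?_) (fun t ht x => ?_) (hAc.mul continuousOn_const)
    (fun t ht => ?_) (fun t ht => ?_)
  · exact (h.smooth_velocity.isSmooth_slice ht).continuous.norm.mul (hEc t ht)
  · exact mul_nonneg (norm_nonneg _) (hE0 t ht x)
  · calc |⟪u t x, Torus.convect (u t) (u t) x⟫| ≤ ‖u t x‖ ^ 3 * E t x := hdom t ht x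
      _ = ‖u t x‖ ^ 2 * (‖u t x‖ * E t x) := by ring
  · have hus : Torus.IsSmooth (u t) := h.smooth_velocity.isSmooth_slice ht
    have h1 := lr_norm_mul_le (by norm_num : (0 : ℝ) < 6) (by norm_num : (0 : ℝ) < 6)
      (by norm_num : (0 : ℝ) < 3) (by norm_num) hus.continuous.norm (hEc t ht)
      (fun x => norm_nonneg _) (hE0 t ht)
    have e6 : ∫ x, ‖u t x‖ ^ (6 : ℝ) = ∫ x, ‖u t x‖ ^ 6 :=
      integral_congr_ae (ae_of_all _ fun x => by
        show ‖u t x‖ ^ (6 : ℝ) = ‖u t x‖ ^ 6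
        rw [show (6 : ℝ) = ((6 : ℕ) : ℝ) by norm_num, Real.rpow_natCast])
    rw [e6] at h1
    exact h1.trans (mul_le_mul_of_nonneg_left (hL t ht) (hA0 t))
  · rcases ht.1.eq_or_lt with h0 | h0t
    · rw [← h0, intervalIntegral.integral_same]; positivity
    have hsub : Icc 0 t ⊆ Ico 0 T := fun s hs => ⟨hs.1, hs.2.trans_lt ht.2⟩
    have e2 : ∀ s, (A s * L) ^ (2 : ℝ) = L ^ 2 * (∫ x, ‖u s x‖ ^ 6) ^ (1 / 3 : ℝ) := by
      intro s
      rw [Real.rpow_two, mul_pow, hA, ← Real.rpow_natCast ((∫ x, ‖u s x‖ ^ 6) ^ (1 / 6 : ℝ)),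
        ← Real.rpow_mul (hI60 s)]
      norm_num; ring
    simp only [e2]
    rw [intervalIntegral.integral_const_mul]
    exact mul_le_mul_of_nonneg_left (hCE t ht) (sq_nonneg _)

end Criterion

end Literature.Analysis.FluidPDE

end
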